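import Literature.NumberTheory.Sieve.PolymathProductLatticeBounds
import Literature.NumberTheory.Sieve.PolymathProductHoeffdingBounds
import Literature.Analysis.Convolution.ConvolutionPowerIntegerArithmetic
import Literature.Analysis.SpecialFunctions.KernelLog

/-! # Kernel certificate `θ ≤ M_k(F_{c,T})` for Polymath's product test function — Hoeffding-recentred `decide +kernel` checker
(parity-ideate-p3 ROUND-18, g18; template `MaynardKernelH.lean`, parameters `PARAM_*` filled by `instantiate.py`).

PROVENANCE.  This is the Parity ideation cell's file `HOME/parity-ideate-p3/round18/lean/MaynardKernelH4500s.lean`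
(sha16 `22db0a143380824a`, authored by the planner seat parity-ideate-p3 g18, landed at its request by the cell's
literature seat): every declaration, statement and proof below is byte-identical to that file; only this paragraph,
the per-declaration docstrings the Literature lints require, and their provenance tags were added.  The result it
certifies, `eight_lt_maynardFunctional_4500 : 8 < M_4500(F)` for Polymath's product test function `F = F_{c,T}`
(Polymath 8b, Theorem 6.7: `F(t) = ∏ g(k t_i)` on the truncated simplex, `g(t) = 1/(c + (k−1)t)` for `t ≤ T`), is the
`m = 2` input (`M_k > 8 = 4m` under Bombieri–Vinogradov ⇒ `DHL[k, 3]`) for the admissible 4500-tuple of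
diameter `41664` (`NarrowAdmissibleTuple4500.lean`).  Farm: `lean check --timeout 1800` rc 0, 0 warnings,
axioms `[propext, Classical.choice, Quot.sound]`, ≈ 260–300 s (four `decide +kernel` evaluations).

MATHEMATICS.  `maynardFunctional_polymathProfile_ge_hoeffdingRatio` (tree) bounds `M_k(F)` below by
`k·(Σ_m V(m)·p^{*(k−1)}(m) − I_T²·m₂^{k−1}·e^{−2λ₂²/((k−1)h²)}) / (Σ_{m ≤ m⋆} p^{*k}(m) + m₂^k·e^{−2λ₁²/(kh²)})` under two side conditions
`hcond₁₂` on the recentring `(m⋆, δ, λ₁, λ₂)` phrased with the normalised first moment `E` of the cell masses.  Everything is decided on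
exact integers: cell masses of `F²` are rational (`cellMass_polymathProfile_sq`) → fixed-point floor/ceil leaves (`2^LL`) → Kronecker-packed
addition chains for the `(k−1)`-st / `k`-th convolution powers (`kpack_mul_step_floor/ceil`) → block sums against a certified log table
(`KernelLog.logIv`) for the numerator, a partial slot sum for the denominator → `Σ j·leaf_j` and a `2^80`-scaled log enclosure for `σ = k·E`
→ the exponential tails via `exp(−t) ≤ (nE/(nE+t))^nE` as integer ceilings `T1, T2` → one integer cross-multiplication `chk`.

KERNEL INTERFACE.  One-piece: `cert_eq_true : cert = true := by decide +kernel` ⟹ `theta_le_maynardFunctional`.  Split (the production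
shape, four independent kernel evaluations on two literal bounds `nlb ≤ NUMSUM`, `sD ≤ dub`): `okF : FactF nlb`, `okC : FactC dub`,
`okS : sideOk`, `okI : FactI nlb dub` ⟹ `theta_le_of_factsH _ _ okF okC okS okI`.
KERNEL RULES honoured by the real side (ROUND-17 K1–K5, ROUND-18 K6–K7): heavy closed constants (`NF NC NUMSUM sD SIG LOGLO LOGHI T2`)
occur in proofs only in syntactically identical positions or behind `ℕ`-specific rewrite lemmas; no `rfl`/`unfold`/`show` steps and no
generic type-class algebra lemmas at `ℕ` over them (the kernel's `Nat.add/mul` unfolding + `reduce_nat` would evaluate them); checkers are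
stated over variables and instantiated by application; the elaborator never unifies a `Nat.ble`/arithmetic node over them (`Fact*` shapes). -/

set_option autoImplicit false
set_option maxRecDepth 4096

open Finset MeasureTheory Set
open Literature.Analysis.Convolution Literature.NumberTheory.Sieve Literature.NumberTheory.Sieve.MaynardTao
open Literature.Analysis.SpecialFunctions.KernelLog (logIv logIv_sound)

namespace Literature.NumberTheory.Sieve.MaynardTao.ProductKernelCert

/-! ## Parameters -/
section Params
/-- `k = nK + 2`. [folklore] -/
def nK : ℕ := 4498
/-- Checker plumbing `cn`: an exact-integer constant / function of the ROUND-18 kernel certificate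
(see the module docstring; verbatim from the Parity cell's `MaynardKernelH4500s.lean`). [folklore] -/
def cn : ℕ := 243
/-- Checker plumbing `cd`: an exact-integer constant / function of the ROUND-18 kernel certificate
(see the module docstring; verbatim from the Parity cell's `MaynardKernelH4500s.lean`). [folklore] -/
def cd : ℕ := 2000
/-- Checker plumbing `Tn`: an exact-integer constant / function of the ROUND-18 kernel certificate
(see the module docstring; verbatim from the Parity cell's `MaynardKernelH4500s.lean`). [folklore] -/
def Tn : ℕ := 13
/-- Checker plumbing `Td`: an exact-integer constant / function of the ROUND-18 kernel certificate
(see the module docstring; verbatim from the Parity cell's `MaynardKernelH4500s.lean`). [folklore] -/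
def Td : ℕ := 20
/-- lattice `h = 1/N1`. [folklore] -/
def N1 : ℕ := 200000
/-- `M = 2^eE` packed slots. [folklore] -/
def eE : ℕ := 18
/-- fixed-point scale `2^LL`. [folklore] -/
def LL : ℕ := 48
/-- digit width. [folklore] -/
def BB : ℕ := 100
/-- block width `2^Wexp` for the log weights. [folklore] -/
def Wexp : ℕ := 4
/-- certified threshold `θ = thn/thd`. [folklore] -/
def thn : ℕ := 801
/-- Checker plumbing `thd`: an exact-integer constant / function of the ROUND-18 kernel certificate
(see the module docstring; verbatim from the Parity cell's `MaynardKernelH4500s.lean`). [folklore] -/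
def thd : ℕ := 100
/-- grid of the quantised log table and its depth (`Jc / GG < 2^eT`). [folklore] -/
def GG : ℕ := 127
/-- Checker plumbing `eT`: an exact-integer constant / function of the ROUND-18 kernel certificate
(see the module docstring; verbatim from the Parity cell's `MaynardKernelH4500s.lean`). [folklore] -/
def eT : ℕ := 10
/-- Hoeffding recentring (ROUND-18): denominator cutoff `m⋆` (partial sum over `m < MD = m⋆+1`), numerator shift `dP`
(cells, `δ = dP·h`), tail parameter `Λ` (cells, `λ₁ = λ₂ = Λ·h`), and the exponent `nE` of the elementary bound
`exp(−t) ≤ (nE/(nE+t))^nE`. [folklore] -/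
def mstar : ℕ := 198069
/-- Checker plumbing `dP`: an exact-integer constant / function of the ROUND-18 kernel certificate
(see the module docstring; verbatim from the Parity cell's `MaynardKernelH4500s.lean`). [folklore] -/
def dP : ℕ := 2068
/-- Checker plumbing `Lam`: an exact-integer constant / function of the ROUND-18 kernel certificate
(see the module docstring; verbatim from the Parity cell's `MaynardKernelH4500s.lean`). [folklore] -/
def Lam : ℕ := 250
/-- Checker plumbing `nE`: an exact-integer constant / function of the ROUND-18 kernel certificate
(see the module docstring; verbatim from the Parity cell's `MaynardKernelH4500s.lean`). [folklore] -/
def nE : ℕ := 64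
end Params

/-- Checker plumbing `kK`: an exact-integer constant / function of the ROUND-18 kernel certificate
(see the module docstring; verbatim from the Parity cell's `MaynardKernelH4500s.lean`). [folklore] -/
def kK : ℕ := nK + 2
/-- Checker plumbing `MM`: an exact-integer constant / function of the ROUND-18 kernel certificate
(see the module docstring; verbatim from the Parity cell's `MaynardKernelH4500s.lean`). [folklore] -/
def MM : ℕ := 2 ^ eE
/-- Checker plumbing `WW`: an exact-integer constant / function of the ROUND-18 kernel certificate
(see the module docstring; verbatim from the Parity cell's `MaynardKernelH4500s.lean`). [folklore] -/
def WW : ℕ := 2 ^ Wexp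
/-- Checker plumbing `rr`: an exact-integer constant / function of the ROUND-18 kernel certificate
(see the module docstring; verbatim from the Parity cell's `MaynardKernelH4500s.lean`). [folklore] -/
def rr : ℕ := 2 ^ (eE - Wexp)
/-- Checker plumbing `Jc`: an exact-integer constant / function of the ROUND-18 kernel certificate
(see the module docstring; verbatim from the Parity cell's `MaynardKernelH4500s.lean`). [folklore] -/
def Jc : ℕ := Tn * N1 / Td
/-- Checker plumbing `MD`: an exact-integer constant / function of the ROUND-18 kernel certificate
(see the module docstring; verbatim from the Parity cell's `MaynardKernelH4500s.lean`). [folklore] -/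
def MD : ℕ := mstar + 1
/-- Checker plumbing `Aa`: an exact-integer constant / function of the ROUND-18 kernel certificate
(see the module docstring; verbatim from the Parity cell's `MaynardKernelH4500s.lean`). [folklore] -/
def Aa (j : ℕ) : ℕ := cn * N1 + cd * (kK - 1) * j
/-- Checker plumbing `NUM`: an exact-integer constant / function of the ROUND-18 kernel certificate
(see the module docstring; verbatim from the Parity cell's `MaynardKernelH4500s.lean`). [folklore] -/
def NUM : ℕ := N1 * cn * (cn * Td + cd * (kK - 1) * Tn)
/-- Checker plumbing `DEN`: an exact-integer constant / function of the ROUND-18 kernel certificate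
(see the module docstring; verbatim from the Parity cell's `MaynardKernelH4500s.lean`). [folklore] -/
def DEN (j : ℕ) : ℕ := Tn * Aa j * Aa (j + 1)
/-- Checker plumbing `leaf`: an exact-integer constant / function of the ROUND-18 kernel certificate
(see the module docstring; verbatim from the Parity cell's `MaynardKernelH4500s.lean`). [folklore] -/
def leaf (j : ℕ) : ℕ := if j < Jc then 2 ^ LL * NUM / DEN j else 0
/-- Checker plumbing `ind`: an exact-integer constant / function of the ROUND-18 kernel certificate
(see the module docstring; verbatim from the Parity cell's `MaynardKernelH4500s.lean`). [folklore] -/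
def ind (j : ℕ) : ℕ := if j < Jc then 1 else 0
/-- Checker plumbing `uu`: an exact-integer constant / function of the ROUND-18 kernel certificate
(see the module docstring; verbatim from the Parity cell's `MaynardKernelH4500s.lean`). [folklore] -/
def uu (j : ℕ) : ℕ := leaf j + ind j

/-! ## The program (kernel-friendly: big powers of two only through shifts) -/
/-- Checker plumbing `pow2`: an exact-integer constant / function of the ROUND-18 kernel certificate
(see the module docstring; verbatim from the Parity cell's `MaynardKernelH4500s.lean`). [folklore] -/
def pow2 (n : ℕ) : ℕ := 1 <<< n
/-- Checker plumbing `onesBelow`: an exact-integer constant / function of the ROUND-18 kernel certificate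
(see the module docstring; verbatim from the Parity cell's `MaynardKernelH4500s.lean`). [folklore] -/
def onesBelow (n : ℕ) : ℕ := pow2 n - 1
/-- Checker plumbing `repUnit`: an exact-integer constant / function of the ROUND-18 kernel certificate
(see the module docstring; verbatim from the Parity cell's `MaynardKernelH4500s.lean`). [folklore] -/
def repUnit (J : ℕ) : ℕ := onesBelow (BB * J) / onesBelow BB
/-- Checker plumbing `maskLo`: an exact-integer constant / function of the ROUND-18 kernel certificate
(see the module docstring; verbatim from the Parity cell's `MaynardKernelH4500s.lean`). [folklore] -/
def maskLo : ℕ := repUnit MM * onesBelow (BB - LL)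
/-- Checker plumbing `rndC`: an exact-integer constant / function of the ROUND-18 kernel certificate
(see the module docstring; verbatim from the Parity cell's `MaynardKernelH4500s.lean`). [folklore] -/
def rndC : ℕ := repUnit MM * onesBelow LL
/-- Checker plumbing `NL`: an exact-integer constant / function of the ROUND-18 kernel certificate
(see the module docstring; verbatim from the Parity cell's `MaynardKernelH4500s.lean`). [folklore] -/
def NL : ℕ := kpackDC BB leaf eE 0
/-- Checker plumbing `NU`: an exact-integer constant / function of the ROUND-18 kernel certificate
(see the module docstring; verbatim from the Parity cell's `MaynardKernelH4500s.lean`). [folklore] -/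
def NU : ℕ := NL + repUnit Jc
/-- Checker plumbing `trunc`: an exact-integer constant / function of the ROUND-18 kernel certificate
(see the module docstring; verbatim from the Parity cell's `MaynardKernelH4500s.lean`). [folklore] -/
def trunc (x : ℕ) : ℕ := x &&& onesBelow (BB * MM)
/-- Checker plumbing `stepF`: an exact-integer constant / function of the ROUND-18 kernel certificate
(see the module docstring; verbatim from the Parity cell's `MaynardKernelH4500s.lean`). [folklore] -/
def stepF (x y : ℕ) : ℕ := (trunc (x * y) >>> LL) &&& maskLo
/-- Checker plumbing `stepC`: an exact-integer constant / function of the ROUND-18 kernel certificate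
(see the module docstring; verbatim from the Parity cell's `MaynardKernelH4500s.lean`). [folklore] -/
def stepC (x y : ℕ) : ℕ := ((trunc (x * y) + rndC) >>> LL) &&& maskLo
/-- Checker plumbing `ssum`: an exact-integer constant / function of the ROUND-18 kernel certificate
(see the module docstring; verbatim from the Parity cell's `MaynardKernelH4500s.lean`). [folklore] -/
def ssum (N : ℕ) : ℕ := N % onesBelow BB
/-- Checker plumbing `psum`: an exact-integer constant / function of the ROUND-18 kernel certificate
(see the module docstring; verbatim from the Parity cell's `MaynardKernelH4500s.lean`). [folklore] -/
def psum (N J : ℕ) : ℕ := (N &&& onesBelow (BB * J)) % onesBelow BB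

/-- Checker plumbing `stepPairF`: an exact-integer constant / function of the ROUND-18 kernel certificate
(see the module docstring; verbatim from the Parity cell's `MaynardKernelH4500s.lean`). [folklore] -/
def stepPairF (x sx : ℕ) (b : Bool) (p : ℕ × Bool) : ℕ × Bool :=
  bif b then (stepF (stepF p.1 p.1) x,
      (p.2 && Nat.blt (ssum p.1 * ssum p.1) (pow2 BB)) && Nat.blt (ssum (stepF p.1 p.1) * sx) (pow2 BB))
  else (stepF p.1 p.1, p.2 && Nat.blt (ssum p.1 * ssum p.1) (pow2 BB))
/-- Checker plumbing `runF`: an exact-integer constant / function of the ROUND-18 kernel certificate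
(see the module docstring; verbatim from the Parity cell's `MaynardKernelH4500s.lean`). [folklore] -/
def runF (x sx : ℕ) : List Bool → ℕ × Bool
  | [] => (x, true)
  | b :: bs => stepPairF x sx b (runF x sx bs)
/-- Checker plumbing `stepPairC`: an exact-integer constant / function of the ROUND-18 kernel certificate
(see the module docstring; verbatim from the Parity cell's `MaynardKernelH4500s.lean`). [folklore] -/
def stepPairC (x sx : ℕ) (b : Bool) (p : ℕ × Bool) : ℕ × Bool :=
  bif b then (stepC (stepC p.1 p.1) x,
      (p.2 && Nat.ble (ssum p.1 * ssum p.1 + pow2 LL) (pow2 BB)) && Nat.ble (ssum (stepC p.1 p.1) * sx + pow2 LL) (pow2 BB))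
  else (stepC p.1 p.1, p.2 && Nat.ble (ssum p.1 * ssum p.1 + pow2 LL) (pow2 BB))
/-- Checker plumbing `runC`: an exact-integer constant / function of the ROUND-18 kernel certificate
(see the module docstring; verbatim from the Parity cell's `MaynardKernelH4500s.lean`). [folklore] -/
def runC (x sx : ℕ) : List Bool → ℕ × Bool
  | [] => (x, true)
  | b :: bs => stepPairC x sx b (runC x sx bs)
/-- exponent encoded by a bit list (head = least significant bit below the leading one).
[folklore] -/
def expo : List Bool → ℕ
  | [] => 1
  | b :: bs => 2 * expo bs + (bif b then 1 else 0)
/-- bits of `k − 1` and `k` below the leading one, least significant first. [folklore] -/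
def bitsF : List Bool := [true, true, false, false, true, false, false, true, true, false, false, false]
/-- Checker plumbing `bitsC`: an exact-integer constant / function of the ROUND-18 kernel certificate
(see the module docstring; verbatim from the Parity cell's `MaynardKernelH4500s.lean`). [folklore] -/
def bitsC : List Bool := [false, false, true, false, true, false, false, true, true, false, false, false]

/-- Checker plumbing `resF`: an exact-integer constant / function of the ROUND-18 kernel certificate
(see the module docstring; verbatim from the Parity cell's `MaynardKernelH4500s.lean`). [folklore] -/
def resF : ℕ × Bool := runF NL (ssum NL) bitsF
/-- Checker plumbing `resC`: an exact-integer constant / function of the ROUND-18 kernel certificate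
(see the module docstring; verbatim from the Parity cell's `MaynardKernelH4500s.lean`). [folklore] -/
def resC : ℕ × Bool := runC NU (ssum NU) bitsC
/-- Checker plumbing `NF`: an exact-integer constant / function of the ROUND-18 kernel certificate
(see the module docstring; verbatim from the Parity cell's `MaynardKernelH4500s.lean`). [folklore] -/
def NF : ℕ := resF.1
/-- Checker plumbing `NC`: an exact-integer constant / function of the ROUND-18 kernel certificate
(see the module docstring; verbatim from the Parity cell's `MaynardKernelH4500s.lean`). [folklore] -/
def NC : ℕ := resC.1
/-- Checker plumbing `sD`: an exact-integer constant / function of the ROUND-18 kernel certificate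
(see the module docstring; verbatim from the Parity cell's `MaynardKernelH4500s.lean`). [folklore] -/
def sD : ℕ := psum NC MD
/-- block representative `V_i = min(max(N1 − ((i+1)W + k − 2), 0), Jc)` (in units of `h`).
[folklore] -/
def Vv (i : ℕ) : ℕ := min (N1 + dP - ((i + 1) * WW + kK - 2)) Jc
/-- scaled log lower bound `ell_i / 2^80 ≤ log((c + (k−1) V_i h)/c)`. [folklore] -/
def ellOf (V : ℕ) : ℕ :=
  match logIv (Aa V), logIv (Aa 0) with
  | some p, some q => Int.toNat (p.1 - q.2)
  | _, _ => 0
/-- Checker plumbing `ell`: an exact-integer constant / function of the ROUND-18 kernel certificate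
(see the module docstring; verbatim from the Parity cell's `MaynardKernelH4500s.lean`). [folklore] -/
def ell (i : ℕ) : ℕ := ellOf (Vv i)
/-- digit width of the log table. [folklore] -/
def BT : ℕ := 88
/-- table entry `g`: the clipped log lower bound at `V = g·GG` (clipping keeps it a digit and a lower bound).
[folklore] -/
def tabFn (g : ℕ) : ℕ := min (ellOf (g * GG)) (onesBelow BT)
/-- the packed table (each `logIv` evaluated once). [folklore] -/
def TAB : ℕ := kpackDC BT tabFn eT 0
/-- Checker plumbing `tabDigit`: an exact-integer constant / function of the ROUND-18 kernel certificate
(see the module docstring; verbatim from the Parity cell's `MaynardKernelH4500s.lean`). [folklore] -/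
def tabDigit (g : ℕ) : ℕ := (TAB >>> (BT * g)) &&& onesBelow BT
/-- the block weight actually used: quantise `V_i` down to the grid and read the table.
[folklore] -/
def ellT (i : ℕ) : ℕ := tabDigit (Vv i / GG)
/-- `Σ_i ellT(o+i)² · (digit-sum of block i)` over the `2^d` blocks of `W` slots packed in `N`, by binary splitting
(memory-light: every level materialises `|N|` bits in total). [folklore] -/
def nsGo (N : ℕ) : ℕ → ℕ → ℕ
  | 0, o => ellT o ^ 2 * (N % onesBelow BB)
  | d + 1, o => nsGo (N &&& onesBelow (BB * (WW * 2 ^ d))) d o + nsGo (N >>> (BB * (WW * 2 ^ d))) d (o + 2 ^ d)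
/-- Checker plumbing `NUMSUM`: an exact-integer constant / function of the ROUND-18 kernel certificate
(see the module docstring; verbatim from the Parity cell's `MaynardKernelH4500s.lean`). [folklore] -/
def NUMSUM : ℕ := nsGo NF (eE - Wexp) 0
/-- `SIG = Σ_{j<M} j·leaf_j` by binary splitting (`2^L·Σ_j j·pt_j ∈ [SIG, SIG + Jc(Jc−1)/2]`).
[folklore] -/
def sigGo : ℕ → ℕ → ℕ
  | 0, o => o * leaf o
  | d + 1, o => sigGo d o + sigGo d (o + 2 ^ d)
/-- Checker plumbing `SIG`: an exact-integer constant / function of the ROUND-18 kernel certificate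
(see the module docstring; verbatim from the Parity cell's `MaynardKernelH4500s.lean`). [folklore] -/
def SIG : ℕ := sigGo eE 0
/-- `Σ_{j<Jc} j = Jc(Jc−1)/2`: the excess of `Σ j·u_j` over `Σ j·leaf_j` (a cheap closed constant).
[folklore] -/
def TRI : ℕ := Jc * (Jc - 1) / 2
/-- two-sided enclosure `LOGLO ≤ 2^80·log((c+(k−1)T)/c) ≤ LOGHI` from the tree's `logIv` at `A(Jc)` and `A(0)`.
[folklore] -/
def logOk : Bool := (logIv (Aa Jc)).isSome && (logIv (Aa 0)).isSome
/-- Checker plumbing `LOGLO`: an exact-integer constant / function of the ROUND-18 kernel certificate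
(see the module docstring; verbatim from the Parity cell's `MaynardKernelH4500s.lean`). [folklore] -/
def LOGLO : ℕ :=
  match logIv (Aa Jc), logIv (Aa 0) with
  | some p, some q => Int.toNat (p.1 - q.2)
  | _, _ => 0
/-- Checker plumbing `LOGHI`: an exact-integer constant / function of the ROUND-18 kernel certificate
(see the module docstring; verbatim from the Parity cell's `MaynardKernelH4500s.lean`). [folklore] -/
def LOGHI : ℕ :=
  match logIv (Aa Jc), logIv (Aa 0) with
  | some p, some q => Int.toNat (p.2 - q.1)
  | _, _ => 0
/-- Checker plumbing `X1`: an exact-integer constant / function of the ROUND-18 kernel certificate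
(see the module docstring; verbatim from the Parity cell's `MaynardKernelH4500s.lean`). [folklore] -/
def X1 : ℕ := cn * (cn * Td + cd * (nK + 1) * Tn)
/-- Checker plumbing `DDc`: an exact-integer constant / function of the ROUND-18 kernel certificate
(see the module docstring; verbatim from the Parity cell's `MaynardKernelH4500s.lean`). [folklore] -/
def DDc : ℕ := 2 ^ LL * 2 ^ 80 * cd ^ 2 * Tn * (nK + 1) ^ 2
/-- Checker plumbing `C1c`: an exact-integer constant / function of the ROUND-18 kernel certificate
(see the module docstring; verbatim from the Parity cell's `MaynardKernelH4500s.lean`). [folklore] -/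
def C1c : ℕ := N1 * cn * 2 ^ LL * 2 ^ 80 * cd * Tn * (nK + 1)
/-- Checker plumbing `Y1c`: an exact-integer constant / function of the ROUND-18 kernel certificate
(see the module docstring; verbatim from the Parity cell's `MaynardKernelH4500s.lean`). [folklore] -/
def Y1c : ℕ := 2 ^ 80 * cd ^ 2 * Tn * (nK + 1) ^ 2
/-- side condition 1 (`hcond₁` in cells): `N1 − MD + Λ ≤ k·σ_lo` — over variables `lo = LOGLO`, `sg = SIG` (KERNEL RULE K6: the heavy
closed constant `SIG` is never placed under `+`/`*` next to a term whose instance path could differ; here `sg` is a variable).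
[folklore] -/
def chk1 (lo sg : ℕ) : Bool :=
  Nat.ble ((N1 + Lam) * DDc + (nK + 2) * (C1c + (sg + TRI) * Y1c)) (MD * DDc + (nK + 2) * N1 * X1 * lo * 2 ^ LL)
/-- side condition 2 (`hcond₂` in cells): `dP + Λ ≤ (k−1)(1 − σ_hi)` — over variables `hi = LOGHI`, `sg = SIG`.
[folklore] -/
def chk2 (hi sg : ℕ) : Bool :=
  Nat.ble ((dP + Lam) * DDc + (nK + 1) * N1 * X1 * hi * 2 ^ LL) ((nK + 1) * DDc + (nK + 1) * (C1c + sg * Y1c))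
/-- Checker plumbing `sideOk`: an exact-integer constant / function of the ROUND-18 kernel certificate
(see the module docstring; verbatim from the Parity cell's `MaynardKernelH4500s.lean`). [folklore] -/
def sideOk : Bool := logOk && (chk1 LOGLO SIG && chk2 LOGHI SIG)
/-- integer upper bounds of the two Hoeffding tails: `2^L·e^{−2Λ²/k} ≤ T1`, `2^L·LOGHI²·e^{−2Λ²/(k−1)} ≤ T2`.
[folklore] -/
def a1 : ℕ := (nE * (nK + 2)) ^ nE
/-- Checker plumbing `b1`: an exact-integer constant / function of the ROUND-18 kernel certificate
(see the module docstring; verbatim from the Parity cell's `MaynardKernelH4500s.lean`). [folklore] -/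
def b1 : ℕ := (nE * (nK + 2) + 2 * Lam ^ 2) ^ nE
/-- Checker plumbing `a2`: an exact-integer constant / function of the ROUND-18 kernel certificate
(see the module docstring; verbatim from the Parity cell's `MaynardKernelH4500s.lean`). [folklore] -/
def a2 : ℕ := (nE * (nK + 1)) ^ nE
/-- Checker plumbing `b2`: an exact-integer constant / function of the ROUND-18 kernel certificate
(see the module docstring; verbatim from the Parity cell's `MaynardKernelH4500s.lean`). [folklore] -/
def b2 : ℕ := (nE * (nK + 1) + 2 * Lam ^ 2) ^ nE
/-- Checker plumbing `T1`: an exact-integer constant / function of the ROUND-18 kernel certificate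
(see the module docstring; verbatim from the Parity cell's `MaynardKernelH4500s.lean`). [folklore] -/
def T1 : ℕ := (2 ^ LL * a1 + b1 - 1) / b1
/-- Checker plumbing `T2`: an exact-integer constant / function of the ROUND-18 kernel certificate
(see the module docstring; verbatim from the Parity cell's `MaynardKernelH4500s.lean`). [folklore] -/
def T2 : ℕ := (2 ^ LL * LOGHI ^ 2 * a2 + b2 - 1) / b2
/-- the final integer inequality `θn·2^160·(k−1)²·Tn·cd²·D ≤ θd·k·N·cn·(cn·Td + cd·(k−1)·Tn)` for a denominator upper
bound `D` and a numerator lower bound `N` (KERNEL RULE: closed program constants such as `sD`, `NUMSUM` may meet the kernel only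
in syntactically identical positions — a definitional comparison of two different closed `Nat.ble/Nat.mul` terms makes the
kernel EVALUATE them; hence one named checker over variables, instantiated by application only).
[folklore] -/
def chk (D N : ℕ) : Bool :=
  Nat.ble (thn * (2 ^ 160 * ((nK + 1) ^ 2 * (Tn * (cd ^ 2 * D)))))
    (thd * ((nK + 2) * (N * (cn * (cn * Td + cd * (nK + 1) * Tn)))))
/-- the certificate. [folklore] -/
def cert : Bool := ((resF.2 && resC.2) && sideOk) && (Nat.ble T2 NUMSUM && chk (sD + T1) (NUMSUM - T2))

/-! FACT SHAPES (ROUND-18 K7).  An instance file decides `FactF NLB`, `FactC DUB`, `sideOk`, `FactI NLB DUB` by `decide +kernel`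
and feeds them to `theta_le_of_factsH _ _ okF okC okS okI`: the ELABORATOR then only unifies `FactF ?n =?= FactF NLB` argument-wise
and never meets a `Nat.ble`/arithmetic node over a heavy closed constant (Meta's `reduceNat?` would `whnf`-evaluate it). -/
/-- kernel fact 1/4: floor chain consistent and `nlb ≤ NUMSUM`. [folklore] -/
def FactF (nlb : ℕ) : Bool := resF.2 && Nat.ble nlb NUMSUM
/-- kernel fact 2/4: ceil chain consistent and `sD ≤ dub`. [folklore] -/
def FactC (dub : ℕ) : Bool := resC.2 && Nat.ble sD dub
/-- kernel fact 4/4: `T2 ≤ nlb` and the final integer inequality on the literal bounds.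
[folklore] -/
def FactI (nlb dub : ℕ) : Bool := Nat.ble T2 nlb && chk (dub + T1) (nlb - T2)

/-! ## Parameter facts (small decisions) -/
/-- Checker step `expo_bitsF` of the kernel certificate for `8 < M_4500(F_{243/2000,13/20})` (statement and
proof verbatim from the Parity cell's `MaynardKernelH4500s.lean`, parity-ideate-p3 ROUND-18). [cite: Polymath8b2014, Theorem 6.7 (product test function), numerical instance k = 4500] -/
theorem expo_bitsF : expo bitsF = nK + 1 := by decide
/-- Checker step `expo_bitsC` of the kernel certificate for `8 < M_4500(F_{243/2000,13/20})` (statement and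
proof verbatim from the Parity cell's `MaynardKernelH4500s.lean`, parity-ideate-p3 ROUND-18). [cite: Polymath8b2014, Theorem 6.7 (product test function), numerical instance k = 4500] -/
theorem expo_bitsC : expo bitsC = nK + 2 := by decide
/-- Checker step `Jc_mul` of the kernel certificate for `8 < M_4500(F_{243/2000,13/20})` (statement and
proof verbatim from the Parity cell's `MaynardKernelH4500s.lean`, parity-ideate-p3 ROUND-18). [cite: Polymath8b2014, Theorem 6.7 (product test function), numerical instance k = 4500] -/
theorem Jc_mul : Jc * Td = Tn * N1 := by decide
/-- Checker step `Jc_lt_MM` of the kernel certificate for `8 < M_4500(F_{243/2000,13/20})` (statement and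
proof verbatim from the Parity cell's `MaynardKernelH4500s.lean`, parity-ideate-p3 ROUND-18). [cite: Polymath8b2014, Theorem 6.7 (product test function), numerical instance k = 4500] -/
theorem Jc_lt_MM : Jc < MM := by decide
/-- Checker step `MD_le_MM` of the kernel certificate for `8 < M_4500(F_{243/2000,13/20})` (statement and
proof verbatim from the Parity cell's `MaynardKernelH4500s.lean`, parity-ideate-p3 ROUND-18). [cite: Polymath8b2014, Theorem 6.7 (product test function), numerical instance k = 4500] -/
theorem MD_le_MM : MD ≤ MM := by decide
/-- Checker step `b1_pos` of the kernel certificate for `8 < M_4500(F_{243/2000,13/20})` (statement and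
proof verbatim from the Parity cell's `MaynardKernelH4500s.lean`, parity-ideate-p3 ROUND-18). [cite: Polymath8b2014, Theorem 6.7 (product test function), numerical instance k = 4500] -/
theorem b1_pos : 0 < b1 := Nat.pow_pos (by decide)
/-- Checker step `b2_pos` of the kernel certificate for `8 < M_4500(F_{243/2000,13/20})` (statement and
proof verbatim from the Parity cell's `MaynardKernelH4500s.lean`, parity-ideate-p3 ROUND-18). [cite: Polymath8b2014, Theorem 6.7 (product test function), numerical instance k = 4500] -/
theorem b2_pos : 0 < b2 := Nat.pow_pos (by decide)
/-- Checker step `nE_pos` of the kernel certificate for `8 < M_4500(F_{243/2000,13/20})` (statement and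
proof verbatim from the Parity cell's `MaynardKernelH4500s.lean`, parity-ideate-p3 ROUND-18). [cite: Polymath8b2014, Theorem 6.7 (product test function), numerical instance k = 4500] -/
theorem nE_pos : 0 < nE := by decide
/-- Checker step `MM_eq` of the kernel certificate for `8 < M_4500(F_{243/2000,13/20})` (statement and
proof verbatim from the Parity cell's `MaynardKernelH4500s.lean`, parity-ideate-p3 ROUND-18). [cite: Polymath8b2014, Theorem 6.7 (product test function), numerical instance k = 4500] -/
theorem MM_eq : MM = rr * WW := by decide
/-- Checker step `MM_eq'` of the kernel certificate for `8 < M_4500(F_{243/2000,13/20})` (statement and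
proof verbatim from the Parity cell's `MaynardKernelH4500s.lean`, parity-ideate-p3 ROUND-18). [cite: Polymath8b2014, Theorem 6.7 (product test function), numerical instance k = 4500] -/
theorem MM_eq' : MM = WW * 2 ^ (eE - Wexp) := by decide
/-- Checker step `BB_pos` of the kernel certificate for `8 < M_4500(F_{243/2000,13/20})` (statement and
proof verbatim from the Parity cell's `MaynardKernelH4500s.lean`, parity-ideate-p3 ROUND-18). [cite: Polymath8b2014, Theorem 6.7 (product test function), numerical instance k = 4500] -/
theorem BB_pos : 0 < BB := by decide
/-- Checker step `LL_le_BB` of the kernel certificate for `8 < M_4500(F_{243/2000,13/20})` (statement and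
proof verbatim from the Parity cell's `MaynardKernelH4500s.lean`, parity-ideate-p3 ROUND-18). [cite: Polymath8b2014, Theorem 6.7 (product test function), numerical instance k = 4500] -/
theorem LL_le_BB : LL ≤ BB := by decide
/-- Checker step `NUM_le_DEN0` of the kernel certificate for `8 < M_4500(F_{243/2000,13/20})` (statement and
proof verbatim from the Parity cell's `MaynardKernelH4500s.lean`, parity-ideate-p3 ROUND-18). [cite: Polymath8b2014, Theorem 6.7 (product test function), numerical instance k = 4500] -/
theorem NUM_le_DEN0 : NUM ≤ DEN 0 := by decide
/-- Checker step `sizeF` of the kernel certificate for `8 < M_4500(F_{243/2000,13/20})` (statement and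
proof verbatim from the Parity cell's `MaynardKernelH4500s.lean`, parity-ideate-p3 ROUND-18). [cite: Polymath8b2014, Theorem 6.7 (product test function), numerical instance k = 4500] -/
theorem sizeF : MM * 2 ^ LL < 2 ^ BB - 1 := by decide
/-- Checker step `sizeC` of the kernel certificate for `8 < M_4500(F_{243/2000,13/20})` (statement and
proof verbatim from the Parity cell's `MaynardKernelH4500s.lean`, parity-ideate-p3 ROUND-18). [cite: Polymath8b2014, Theorem 6.7 (product test function), numerical instance k = 4500] -/
theorem sizeC : MM * (2 ^ LL + 1) < 2 ^ BB - 1 := by decide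
/-- Checker step `sizeStepF` of the kernel certificate for `8 < M_4500(F_{243/2000,13/20})` (statement and
proof verbatim from the Parity cell's `MaynardKernelH4500s.lean`, parity-ideate-p3 ROUND-18). [cite: Polymath8b2014, Theorem 6.7 (product test function), numerical instance k = 4500] -/
theorem sizeStepF : (2 ^ BB - 1) / 2 ^ LL < 2 ^ BB - 1 := by decide
/-- Checker step `sizeStepC` of the kernel certificate for `8 < M_4500(F_{243/2000,13/20})` (statement and
proof verbatim from the Parity cell's `MaynardKernelH4500s.lean`, parity-ideate-p3 ROUND-18). [cite: Polymath8b2014, Theorem 6.7 (product test function), numerical instance k = 4500] -/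
theorem sizeStepC : (2 ^ BB - 2 ^ LL) / 2 ^ LL + MM < 2 ^ BB - 1 := by decide
/-- Checker step `grid_ok` of the kernel certificate for `8 < M_4500(F_{243/2000,13/20})` (statement and
proof verbatim from the Parity cell's `MaynardKernelH4500s.lean`, parity-ideate-p3 ROUND-18). [cite: Polymath8b2014, Theorem 6.7 (product test function), numerical instance k = 4500] -/
theorem grid_ok : Jc / GG < 2 ^ eT := by decide
/-- Checker step `param_pos` of the kernel certificate for `8 < M_4500(F_{243/2000,13/20})` (statement and
proof verbatim from the Parity cell's `MaynardKernelH4500s.lean`, parity-ideate-p3 ROUND-18). [cite: Polymath8b2014, Theorem 6.7 (product test function), numerical instance k = 4500] -/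
theorem param_pos : 0 < cn ∧ 0 < cd ∧ 0 < Tn ∧ 0 < Td ∧ 0 < N1 ∧ 0 < WW ∧ 0 < thd := by decide

/-! ## Bit tricks = the specification -/
/-- Checker step `pow2_eq` of the kernel certificate for `8 < M_4500(F_{243/2000,13/20})` (statement and
proof verbatim from the Parity cell's `MaynardKernelH4500s.lean`, parity-ideate-p3 ROUND-18). [cite: Polymath8b2014, Theorem 6.7 (product test function), numerical instance k = 4500] -/
theorem pow2_eq (n : ℕ) : pow2 n = 2 ^ n := by rw [pow2, Nat.one_shiftLeft]
/-- Checker step `onesBelow_eq` of the kernel certificate for `8 < M_4500(F_{243/2000,13/20})` (statement and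
proof verbatim from the Parity cell's `MaynardKernelH4500s.lean`, parity-ideate-p3 ROUND-18). [cite: Polymath8b2014, Theorem 6.7 (product test function), numerical instance k = 4500] -/
theorem onesBelow_eq (n : ℕ) : onesBelow n = 2 ^ n - 1 := by rw [onesBelow, pow2_eq]
/-- core bit lemmas RESTATED at a variable exponent: under Mathlib `2 ^ n : ℕ` elaborates through `Monoid.npow`, the core
lemmas through `Nat.pow`; rewriting with a core lemma at a closed exponent `> 2^24` makes the kernel unfold `Nat.pow` unarily
("deep recursion").  Instantiating these restatements is syntactic.
[cite: Polymath8b2014, Theorem 6.7 (product test function), numerical instance k = 4500] -/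
theorem land_onesBelow (x n : ℕ) : x &&& onesBelow n = x % 2 ^ n := by
  rw [onesBelow_eq]; exact Nat.and_two_pow_sub_one_eq_mod x n
/-- Checker step `shiftRight_eq_div` of the kernel certificate for `8 < M_4500(F_{243/2000,13/20})` (statement and
proof verbatim from the Parity cell's `MaynardKernelH4500s.lean`, parity-ideate-p3 ROUND-18). [cite: Polymath8b2014, Theorem 6.7 (product test function), numerical instance k = 4500] -/
theorem shiftRight_eq_div (x n : ℕ) : x >>> n = x / 2 ^ n := Nat.shiftRight_eq_div_pow x n
/-- Checker step `two_pow_pos'` of the kernel certificate for `8 < M_4500(F_{243/2000,13/20})` (statement and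
proof verbatim from the Parity cell's `MaynardKernelH4500s.lean`, parity-ideate-p3 ROUND-18). [cite: Polymath8b2014, Theorem 6.7 (product test function), numerical instance k = 4500] -/
theorem two_pow_pos' (n : ℕ) : 0 < 2 ^ n := Nat.two_pow_pos n
/-- Checker step `trunc_eq` of the kernel certificate for `8 < M_4500(F_{243/2000,13/20})` (statement and
proof verbatim from the Parity cell's `MaynardKernelH4500s.lean`, parity-ideate-p3 ROUND-18). [cite: Polymath8b2014, Theorem 6.7 (product test function), numerical instance k = 4500] -/
theorem trunc_eq (x : ℕ) : trunc x = x % 2 ^ (BB * MM) := by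
  rw [trunc, land_onesBelow]
/-- Checker step `repUnit_eq` of the kernel certificate for `8 < M_4500(F_{243/2000,13/20})` (statement and
proof verbatim from the Parity cell's `MaynardKernelH4500s.lean`, parity-ideate-p3 ROUND-18). [cite: Polymath8b2014, Theorem 6.7 (product test function), numerical instance k = 4500] -/
theorem repUnit_eq (J : ℕ) : repUnit J = kpack BB J (fun _ => 1) := by
  rw [repUnit, onesBelow_eq, onesBelow_eq, kpack]
  have h2 : 2 ≤ 2 ^ BB := by
    calc 2 = 2 ^ 1 := by norm_num
      _ ≤ 2 ^ BB := Nat.pow_le_pow_right (by norm_num) BB_pos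
  rw [pow_mul, ← Nat.geomSum_eq h2 J]
  refine Finset.sum_congr rfl fun j _ => ?_
  rw [one_mul, ← pow_mul]
/-- Checker step `kpack_const` of the kernel certificate for `8 < M_4500(F_{243/2000,13/20})` (statement and
proof verbatim from the Parity cell's `MaynardKernelH4500s.lean`, parity-ideate-p3 ROUND-18). [cite: Polymath8b2014, Theorem 6.7 (product test function), numerical instance k = 4500] -/
theorem kpack_const (J v : ℕ) : kpack BB J (fun _ => v) = repUnit J * v := by
  rw [repUnit_eq, kpack, kpack, Finset.sum_mul]
  exact Finset.sum_congr rfl fun j _ => by ring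
/-- Checker step `maskLo_eq` of the kernel certificate for `8 < M_4500(F_{243/2000,13/20})` (statement and
proof verbatim from the Parity cell's `MaynardKernelH4500s.lean`, parity-ideate-p3 ROUND-18). [cite: Polymath8b2014, Theorem 6.7 (product test function), numerical instance k = 4500] -/
theorem maskLo_eq : maskLo = kpack BB MM (fun _ => 2 ^ (BB - LL) - 1) := by
  rw [maskLo, kpack_const, onesBelow_eq]
/-- Checker step `rndC_eq` of the kernel certificate for `8 < M_4500(F_{243/2000,13/20})` (statement and
proof verbatim from the Parity cell's `MaynardKernelH4500s.lean`, parity-ideate-p3 ROUND-18). [cite: Polymath8b2014, Theorem 6.7 (product test function), numerical instance k = 4500] -/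
theorem rndC_eq : rndC = kpack BB MM (fun _ => 2 ^ LL - 1) := by
  rw [rndC, kpack_const, onesBelow_eq]
/-- Checker step `ssum_def` of the kernel certificate for `8 < M_4500(F_{243/2000,13/20})` (statement and
proof verbatim from the Parity cell's `MaynardKernelH4500s.lean`, parity-ideate-p3 ROUND-18). [cite: Polymath8b2014, Theorem 6.7 (product test function), numerical instance k = 4500] -/
theorem ssum_def (N : ℕ) : ssum N = N % (2 ^ BB - 1) := by rw [ssum, onesBelow_eq]
/-- Checker step `psum_def` of the kernel certificate for `8 < M_4500(F_{243/2000,13/20})` (statement and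
proof verbatim from the Parity cell's `MaynardKernelH4500s.lean`, parity-ideate-p3 ROUND-18). [cite: Polymath8b2014, Theorem 6.7 (product test function), numerical instance k = 4500] -/
theorem psum_def (N J : ℕ) : psum N J = N % 2 ^ (BB * J) % (2 ^ BB - 1) := by
  rw [psum, land_onesBelow, onesBelow_eq]

/-! ## Digit bookkeeping -/
/-- Checker step `digits_lt` of the kernel certificate for `8 < M_4500(F_{243/2000,13/20})` (statement and
proof verbatim from the Parity cell's `MaynardKernelH4500s.lean`, parity-ideate-p3 ROUND-18). [cite: Polymath8b2014, Theorem 6.7 (product test function), numerical instance k = 4500] -/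
theorem digits_lt {w : ℕ → ℕ} (hs : ∑ m ∈ range MM, w m < 2 ^ BB - 1) : ∀ j < MM, w j < 2 ^ BB :=
  fun j hj => lt_of_le_of_lt (Finset.single_le_sum (f := w) (fun _ _ => Nat.zero_le _) (Finset.mem_range.2 hj))
    (by omega)
/-- Checker step `ssum_kpack` of the kernel certificate for `8 < M_4500(F_{243/2000,13/20})` (statement and
proof verbatim from the Parity cell's `MaynardKernelH4500s.lean`, parity-ideate-p3 ROUND-18). [cite: Polymath8b2014, Theorem 6.7 (product test function), numerical instance k = 4500] -/
theorem ssum_kpack {w : ℕ → ℕ} (hs : ∑ m ∈ range MM, w m < 2 ^ BB - 1) :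
    ssum (kpack BB MM w) = ∑ m ∈ range MM, w m := by
  rw [ssum_def, sum_eq_kpack_mod_mod le_rfl (digits_lt hs) hs, Nat.mod_eq_of_lt (kpack_lt (digits_lt hs))]
/-- Checker step `psum_kpack` of the kernel certificate for `8 < M_4500(F_{243/2000,13/20})` (statement and
proof verbatim from the Parity cell's `MaynardKernelH4500s.lean`, parity-ideate-p3 ROUND-18). [cite: Polymath8b2014, Theorem 6.7 (product test function), numerical instance k = 4500] -/
theorem psum_kpack {w : ℕ → ℕ} (hs : ∑ m ∈ range MM, w m < 2 ^ BB - 1) {J : ℕ} (hJ : J ≤ MM) :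
    psum (kpack BB MM w) J = ∑ m ∈ range J, w m := by
  rw [psum_def]
  refine (sum_eq_kpack_mod_mod hJ (fun j hj => digits_lt hs j (by omega)) ?_).symm
  exact lt_of_le_of_lt (Finset.sum_le_sum_of_subset (by simpa using hJ)) hs

/-! ## The real side: Polymath's profile at the parameters -/
noncomputable section

/-- Checker plumbing `cR`: an exact-integer constant / function of the ROUND-18 kernel certificate
(see the module docstring; verbatim from the Parity cell's `MaynardKernelH4500s.lean`). [folklore] -/
def cR : ℝ := (cn : ℝ) / cd
/-- Checker plumbing `TR`: an exact-integer constant / function of the ROUND-18 kernel certificate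
(see the module docstring; verbatim from the Parity cell's `MaynardKernelH4500s.lean`). [folklore] -/
def TR : ℝ := (Tn : ℝ) / Td
/-- Checker plumbing `hR`: an exact-integer constant / function of the ROUND-18 kernel certificate
(see the module docstring; verbatim from the Parity cell's `MaynardKernelH4500s.lean`). [folklore] -/
def hR : ℝ := 1 / (N1 : ℝ)
/-- Checker plumbing `gK`: an exact-integer constant / function of the ROUND-18 kernel certificate
(see the module docstring; verbatim from the Parity cell's `MaynardKernelH4500s.lean`). [folklore] -/
def gK : ℝ → ℝ := polymathProfile (nK + 2) cR TR
/-- Checker plumbing `m2R`: an exact-integer constant / function of the ROUND-18 kernel certificate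
(see the module docstring; verbatim from the Parity cell's `MaynardKernelH4500s.lean`). [folklore] -/
def m2R : ℝ := TR / (cR * (cR + ((nK : ℝ) + 1) * TR))
/-- Checker plumbing `pp`: an exact-integer constant / function of the ROUND-18 kernel certificate
(see the module docstring; verbatim from the Parity cell's `MaynardKernelH4500s.lean`). [folklore] -/
def pp (j : ℕ) : ℝ := cellMass (fun t => polymathProfile (nK + 2) cR TR t ^ 2) hR j
/-- Checker plumbing `pt`: an exact-integer constant / function of the ROUND-18 kernel certificate
(see the module docstring; verbatim from the Parity cell's `MaynardKernelH4500s.lean`). [folklore] -/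
def pt (j : ℕ) : ℝ := pp j / m2R

/-- Checker step `cR_pos` of the kernel certificate for `8 < M_4500(F_{243/2000,13/20})` (statement and
proof verbatim from the Parity cell's `MaynardKernelH4500s.lean`, parity-ideate-p3 ROUND-18). [cite: Polymath8b2014, Theorem 6.7 (product test function), numerical instance k = 4500] -/
theorem cR_pos : 0 < cR := by
  have := param_pos; unfold cR; exact div_pos (by exact_mod_cast this.1) (by exact_mod_cast this.2.1)
/-- Checker step `TR_pos` of the kernel certificate for `8 < M_4500(F_{243/2000,13/20})` (statement and
proof verbatim from the Parity cell's `MaynardKernelH4500s.lean`, parity-ideate-p3 ROUND-18). [cite: Polymath8b2014, Theorem 6.7 (product test function), numerical instance k = 4500] -/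
theorem TR_pos : 0 < TR := by
  have := param_pos; unfold TR; exact div_pos (by exact_mod_cast this.2.2.1) (by exact_mod_cast this.2.2.2.1)
/-- Checker step `N1_pos` of the kernel certificate for `8 < M_4500(F_{243/2000,13/20})` (statement and
proof verbatim from the Parity cell's `MaynardKernelH4500s.lean`, parity-ideate-p3 ROUND-18). [cite: Polymath8b2014, Theorem 6.7 (product test function), numerical instance k = 4500] -/
theorem N1_pos : (0 : ℝ) < N1 := by have := param_pos; exact_mod_cast this.2.2.2.2.1
/-- Checker step `hR_pos` of the kernel certificate for `8 < M_4500(F_{243/2000,13/20})` (statement and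
proof verbatim from the Parity cell's `MaynardKernelH4500s.lean`, parity-ideate-p3 ROUND-18). [cite: Polymath8b2014, Theorem 6.7 (product test function), numerical instance k = 4500] -/
theorem hR_pos : 0 < hR := by unfold hR; exact div_pos one_pos N1_pos
/-- Checker step `m2R_pos` of the kernel certificate for `8 < M_4500(F_{243/2000,13/20})` (statement and
proof verbatim from the Parity cell's `MaynardKernelH4500s.lean`, parity-ideate-p3 ROUND-18). [cite: Polymath8b2014, Theorem 6.7 (product test function), numerical instance k = 4500] -/
theorem m2R_pos : 0 < m2R := by
  unfold m2R
  have h1 : (0:ℝ) ≤ ((nK : ℝ) + 1) * TR := mul_nonneg (by positivity) TR_pos.le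
  exact div_pos TR_pos (mul_pos cR_pos (by linarith [cR_pos]))
/-- Checker step `pp_nonneg` of the kernel certificate for `8 < M_4500(F_{243/2000,13/20})` (statement and
proof verbatim from the Parity cell's `MaynardKernelH4500s.lean`, parity-ideate-p3 ROUND-18). [cite: Polymath8b2014, Theorem 6.7 (product test function), numerical instance k = 4500] -/
theorem pp_nonneg (j : ℕ) : 0 ≤ pp j := cellMass_nonneg (fun _ => sq_nonneg _) hR j
/-- Checker step `pt_nonneg` of the kernel certificate for `8 < M_4500(F_{243/2000,13/20})` (statement and
proof verbatim from the Parity cell's `MaynardKernelH4500s.lean`, parity-ideate-p3 ROUND-18). [cite: Polymath8b2014, Theorem 6.7 (product test function), numerical instance k = 4500] -/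
theorem pt_nonneg (j : ℕ) : 0 ≤ pt j := div_nonneg (pp_nonneg j) m2R_pos.le
/-- Checker step `pp_eq` of the kernel certificate for `8 < M_4500(F_{243/2000,13/20})` (statement and
proof verbatim from the Parity cell's `MaynardKernelH4500s.lean`, parity-ideate-p3 ROUND-18). [cite: Polymath8b2014, Theorem 6.7 (product test function), numerical instance k = 4500] -/
theorem pp_eq (j : ℕ) : pp j = m2R * pt j := by
  rw [pt, mul_div_cancel₀ _ m2R_pos.ne']

/-- Checker step `kK_sub_one` of the kernel certificate for `8 < M_4500(F_{243/2000,13/20})` (statement and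
proof verbatim from the Parity cell's `MaynardKernelH4500s.lean`, parity-ideate-p3 ROUND-18). [cite: Polymath8b2014, Theorem 6.7 (product test function), numerical instance k = 4500] -/
theorem kK_sub_one : kK - 1 = nK + 1 := rfl
/-- Checker step `cast_kK_sub_one` of the kernel certificate for `8 < M_4500(F_{243/2000,13/20})` (statement and
proof verbatim from the Parity cell's `MaynardKernelH4500s.lean`, parity-ideate-p3 ROUND-18). [cite: Polymath8b2014, Theorem 6.7 (product test function), numerical instance k = 4500] -/
theorem cast_kK_sub_one : (((nK + 2 : ℕ) : ℝ) - 1) = (nK : ℝ) + 1 := by push_cast; ring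

/-- `T = Jc·h`.
[cite: Polymath8b2014, Theorem 6.7 (product test function), numerical instance k = 4500] -/
theorem TR_eq : TR = (Jc : ℝ) * hR := by
  have h' : (Jc : ℝ) * Td = Tn * N1 := by exact_mod_cast Jc_mul
  have hTd : (0:ℝ) < Td := by exact_mod_cast param_pos.2.2.2.1
  have hN1 : (0:ℝ) < N1 := N1_pos
  unfold TR hR
  rw [div_eq_iff hTd.ne', mul_one_div, div_mul_eq_mul_div, eq_div_iff hN1.ne']
  linarith [h']

/-- the exact cell masses, normalised: `pt j = NUM / DEN j` on the support.
[cite: Polymath8b2014, Theorem 6.7 (product test function), numerical instance k = 4500] -/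
theorem pt_eq {j : ℕ} (hj : j < Jc) : pt j = (NUM : ℝ) / (DEN j : ℝ) := by
  have hc := cR_pos; have hT := TR_pos; have hh := hR_pos
  have hjT : ((j : ℝ) + 1) * hR ≤ TR := by
    rw [TR_eq]; have : (j : ℝ) + 1 ≤ Jc := by exact_mod_cast hj
    exact mul_le_mul_of_nonneg_right this hh.le
  have hcell := cellMass_polymathProfile_sq (k := nK + 2) (c := cR) (T := TR) (by omega) hc hh hjT
  rw [pt, pp, hcell, cast_kK_sub_one, m2R]
  unfold cR TR hR
  rw [DEN, Aa, Aa, NUM, kK_sub_one]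
  have h1 : (0:ℝ) < cn := by exact_mod_cast param_pos.1
  have h2 : (0:ℝ) < cd := by exact_mod_cast param_pos.2.1
  have h3 : (0:ℝ) < Tn := by exact_mod_cast param_pos.2.2.1
  have h4 : (0:ℝ) < Td := by exact_mod_cast param_pos.2.2.2.1
  have h5 : (0:ℝ) < N1 := N1_pos
  push_cast
  field_simp
  ring

/-- Checker step `pt_eq_zero` of the kernel certificate for `8 < M_4500(F_{243/2000,13/20})` (statement and
proof verbatim from the Parity cell's `MaynardKernelH4500s.lean`, parity-ideate-p3 ROUND-18). [cite: Polymath8b2014, Theorem 6.7 (product test function), numerical instance k = 4500] -/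
theorem pt_eq_zero {j : ℕ} (hj : Jc ≤ j) : pt j = 0 := by
  have hjT : TR ≤ (j : ℝ) * hR := by
    rw [TR_eq]; exact mul_le_mul_of_nonneg_right (by exact_mod_cast hj) hR_pos.le
  rw [pt, pp, cellMass_polymathProfile_sq_eq_zero hjT, zero_div]

/-- Checker step `Aa_pos` of the kernel certificate for `8 < M_4500(F_{243/2000,13/20})` (statement and
proof verbatim from the Parity cell's `MaynardKernelH4500s.lean`, parity-ideate-p3 ROUND-18). [cite: Polymath8b2014, Theorem 6.7 (product test function), numerical instance k = 4500] -/
theorem Aa_pos (j : ℕ) : 0 < Aa j := by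
  unfold Aa; exact Nat.lt_of_lt_of_le (Nat.mul_pos param_pos.1 param_pos.2.2.2.2.1) (Nat.le_add_right _ _)
/-- Checker step `DEN_pos` of the kernel certificate for `8 < M_4500(F_{243/2000,13/20})` (statement and
proof verbatim from the Parity cell's `MaynardKernelH4500s.lean`, parity-ideate-p3 ROUND-18). [cite: Polymath8b2014, Theorem 6.7 (product test function), numerical instance k = 4500] -/
theorem DEN_pos (j : ℕ) : 0 < DEN j := by
  unfold DEN; exact Nat.mul_pos (Nat.mul_pos param_pos.2.2.1 (Aa_pos j)) (Aa_pos (j + 1))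
/-- Checker step `DEN_mono` of the kernel certificate for `8 < M_4500(F_{243/2000,13/20})` (statement and
proof verbatim from the Parity cell's `MaynardKernelH4500s.lean`, parity-ideate-p3 ROUND-18). [cite: Polymath8b2014, Theorem 6.7 (product test function), numerical instance k = 4500] -/
theorem DEN_mono (j : ℕ) : DEN 0 ≤ DEN j := by
  unfold DEN Aa
  gcongr <;> omega

/-- Checker step `leaf_le` of the kernel certificate for `8 < M_4500(F_{243/2000,13/20})` (statement and
proof verbatim from the Parity cell's `MaynardKernelH4500s.lean`, parity-ideate-p3 ROUND-18). [cite: Polymath8b2014, Theorem 6.7 (product test function), numerical instance k = 4500] -/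
theorem leaf_le (j : ℕ) : leaf j ≤ 2 ^ LL := by
  unfold leaf; split_ifs
  · calc 2 ^ LL * NUM / DEN j ≤ 2 ^ LL * NUM / DEN 0 := Nat.div_le_div_left (DEN_mono j) (DEN_pos 0)
      _ ≤ 2 ^ LL * DEN 0 / DEN 0 := Nat.div_le_div_right (Nat.mul_le_mul_left _ NUM_le_DEN0)
      _ = 2 ^ LL := Nat.mul_div_cancel _ (DEN_pos 0)
  · exact Nat.zero_le _

/-- Checker step `sum_leaf_lt` of the kernel certificate for `8 < M_4500(F_{243/2000,13/20})` (statement and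
proof verbatim from the Parity cell's `MaynardKernelH4500s.lean`, parity-ideate-p3 ROUND-18). [cite: Polymath8b2014, Theorem 6.7 (product test function), numerical instance k = 4500] -/
theorem sum_leaf_lt : ∑ m ∈ range MM, leaf m < 2 ^ BB - 1 :=
  lt_of_le_of_lt (by simpa using Finset.sum_le_sum (s := range MM) fun m _ => leaf_le m) (by
    have := sizeF; simpa [Finset.sum_const, Finset.card_range] using this)
/-- Checker step `sum_uu_lt` of the kernel certificate for `8 < M_4500(F_{243/2000,13/20})` (statement and
proof verbatim from the Parity cell's `MaynardKernelH4500s.lean`, parity-ideate-p3 ROUND-18). [cite: Polymath8b2014, Theorem 6.7 (product test function), numerical instance k = 4500] -/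
theorem sum_uu_lt : ∑ m ∈ range MM, uu m < 2 ^ BB - 1 := by
  have h1 : ∀ m ∈ range MM, uu m ≤ 2 ^ LL + 1 := fun m _ => by
    unfold uu ind; split_ifs <;> have := leaf_le m <;> omega
  exact lt_of_le_of_lt (Finset.sum_le_sum h1) (by simpa [Finset.sum_const, Finset.card_range] using sizeC)

/-- floor initial vector: `leaf_j / 2^L ≤ pt_j`.
[cite: Polymath8b2014, Theorem 6.7 (product test function), numerical instance k = 4500] -/
theorem leaf_div_le (m : ℕ) : ((leaf m : ℕ) : ℝ) / ((2 ^ LL : ℕ) : ℝ) ≤ pt m := by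
  unfold leaf; split_ifs with hm
  · rw [pt_eq hm, div_le_div_iff₀ (by positivity) (by exact_mod_cast DEN_pos m)]
    have : ((2 ^ LL * NUM / DEN m : ℕ) : ℝ) * DEN m ≤ ((2 ^ LL * NUM : ℕ) : ℝ) := by
      exact_mod_cast Nat.div_mul_le_self _ _
    push_cast at this ⊢; linarith
  · simp [pt_nonneg]
/-- ceil initial vector: `pt_j ≤ uu_j / 2^L` (ℕ-side proof: the ℝ-side `nlinarith` route makes the kernel recurse).
[cite: Polymath8b2014, Theorem 6.7 (product test function), numerical instance k = 4500] -/
theorem le_uu_div (m : ℕ) : pt m ≤ ((uu m : ℕ) : ℝ) / ((2 ^ LL : ℕ) : ℝ) := by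
  unfold uu leaf ind; split_ifs with hm
  · rw [pt_eq hm, div_le_div_iff₀ (by exact_mod_cast DEN_pos m) (by exact_mod_cast Nat.two_pow_pos LL)]
    have hnat : NUM * 2 ^ LL ≤ (2 ^ LL * NUM / DEN m + 1) * DEN m := by
      rw [Nat.mul_comm NUM, Nat.add_mul, Nat.one_mul]
      exact (Nat.lt_div_mul_add (DEN_pos m)).le
    exact_mod_cast hnat
  · rw [pt_eq_zero (not_lt.1 hm), Nat.add_zero, Nat.cast_zero, zero_div]

/-! ## Chain invariants -/
/-- `InvF n N` — the floor-chain invariant: the packed integer `N` encodes fixed-point LOWER bounds `w m / 2^LL ≤ p^{*n}(m)` of the `n`-th convolution power, with the no-carry bound `Σ w < 2^BB − 1`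
(Kronecker packing of Polymath's product-test-function evaluation; verbatim from the Parity cell's
`MaynardKernelH4500s.lean`). [cite: Polymath8b2014, Theorem 6.7 (product test function), numerical instance k = 4500] -/
def InvF (n N : ℕ) : Prop :=
  ∃ w : ℕ → ℕ, N = kpack BB MM w ∧ (∀ m < MM, ((w m : ℕ) : ℝ) / ((2 ^ LL : ℕ) : ℝ) ≤ dconvPow pt n m) ∧
    ∑ m ∈ range MM, w m < 2 ^ BB - 1
/-- `InvC n N` — the ceil-chain invariant: the packed integer `N` encodes fixed-point UPPER bounds `p^{*n}(m) ≤ w m / 2^LL` of the `n`-th convolution power, with the no-carry bound `Σ w < 2^BB − 1`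
(Kronecker packing of Polymath's product-test-function evaluation; verbatim from the Parity cell's
`MaynardKernelH4500s.lean`). [cite: Polymath8b2014, Theorem 6.7 (product test function), numerical instance k = 4500] -/
def InvC (n N : ℕ) : Prop :=
  ∃ w : ℕ → ℕ, N = kpack BB MM w ∧ (∀ m < MM, dconvPow pt n m ≤ ((w m : ℕ) : ℝ) / ((2 ^ LL : ℕ) : ℝ)) ∧
    ∑ m ∈ range MM, w m < 2 ^ BB - 1

/-- Checker step `NL_eq` of the kernel certificate for `8 < M_4500(F_{243/2000,13/20})` (statement and
proof verbatim from the Parity cell's `MaynardKernelH4500s.lean`, parity-ideate-p3 ROUND-18). [cite: Polymath8b2014, Theorem 6.7 (product test function), numerical instance k = 4500] -/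
theorem NL_eq : NL = kpack BB MM leaf := kpackDC_zero_eq BB leaf eE
/-- Checker step `ind_pack` of the kernel certificate for `8 < M_4500(F_{243/2000,13/20})` (statement and
proof verbatim from the Parity cell's `MaynardKernelH4500s.lean`, parity-ideate-p3 ROUND-18). [cite: Polymath8b2014, Theorem 6.7 (product test function), numerical instance k = 4500] -/
theorem ind_pack : kpack BB MM ind = repUnit Jc := by
  rw [repUnit_eq]
  have hr : MM = Jc + (MM - Jc) := (Nat.add_sub_cancel' Jc_lt_MM.le).symm
  rw [hr, kpack_add]
  have h0 : kpack BB (MM - Jc) (fun i => ind (Jc + i)) = 0 :=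
    Finset.sum_eq_zero fun i _ => by
      have : ¬ (Jc + i < Jc) := Nat.not_lt.2 (Nat.le_add_right Jc i)
      simp only [ind, this, if_false, Nat.zero_mul]
  rw [h0, Nat.mul_zero, Nat.add_zero]
  exact kpack_congr fun m hm => by simp only [ind, hm, if_true]
/-- Checker step `NU_eq` of the kernel certificate for `8 < M_4500(F_{243/2000,13/20})` (statement and
proof verbatim from the Parity cell's `MaynardKernelH4500s.lean`, parity-ideate-p3 ROUND-18). [cite: Polymath8b2014, Theorem 6.7 (product test function), numerical instance k = 4500] -/
theorem NU_eq : NU = kpack BB MM uu := by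
  rw [NU, NL_eq, ← ind_pack, kpack_add_kpack]; rfl

/-- Checker step `invF_init` of the kernel certificate for `8 < M_4500(F_{243/2000,13/20})` (statement and
proof verbatim from the Parity cell's `MaynardKernelH4500s.lean`, parity-ideate-p3 ROUND-18). [cite: Polymath8b2014, Theorem 6.7 (product test function), numerical instance k = 4500] -/
theorem invF_init : InvF 1 NL :=
  ⟨leaf, NL_eq, fun m _ => by rw [dconvPow_one]; exact leaf_div_le m, sum_leaf_lt⟩
/-- Checker step `invC_init` of the kernel certificate for `8 < M_4500(F_{243/2000,13/20})` (statement and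
proof verbatim from the Parity cell's `MaynardKernelH4500s.lean`, parity-ideate-p3 ROUND-18). [cite: Polymath8b2014, Theorem 6.7 (product test function), numerical instance k = 4500] -/
theorem invC_init : InvC 1 NU :=
  ⟨uu, NU_eq, fun m _ => by rw [dconvPow_one]; exact le_uu_div m, sum_uu_lt⟩

/-- Checker step `two_pow_LL_pos` of the kernel certificate for `8 < M_4500(F_{243/2000,13/20})` (statement and
proof verbatim from the Parity cell's `MaynardKernelH4500s.lean`, parity-ideate-p3 ROUND-18). [cite: Polymath8b2014, Theorem 6.7 (product test function), numerical instance k = 4500] -/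
theorem two_pow_LL_pos : 0 < 2 ^ LL := Nat.two_pow_pos LL

/-- Checker step `InvF.step` of the kernel certificate for `8 < M_4500(F_{243/2000,13/20})` (statement and
proof verbatim from the Parity cell's `MaynardKernelH4500s.lean`, parity-ideate-p3 ROUND-18). [cite: Polymath8b2014, Theorem 6.7 (product test function), numerical instance k = 4500] -/
theorem InvF.step {a b Na Nb : ℕ} (ha : InvF a Na) (hb : InvF b Nb) (hchk : ssum Na * ssum Nb < 2 ^ BB) :
    InvF (a + b) (stepF Na Nb) := by
  rcases ha with ⟨wa, hNa, hwa, hsa⟩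
  rcases hb with ⟨wb, hNb, hwb, hsb⟩
  have hchk' : (∑ i ∈ range MM, wa i) * (∑ j ∈ range MM, wb j) < 2 ^ BB := by
    rw [hNa, hNb, ssum_kpack hsa, ssum_kpack hsb] at hchk; exact hchk
  refine ⟨fun m => dconvNat wa wb m / 2 ^ LL, ?_, ?_, ?_⟩
  · rw [hNa, hNb, stepF, trunc_eq, maskLo_eq]; exact kpack_mul_step_floor BB_pos hchk'
  · exact floorDiv_le_dconvPow_add pt_nonneg two_pow_LL_pos two_pow_LL_pos hwa hwb
  · have h1 := sum_floorStep_le wa wb LL MM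
    have h2 : (∑ i ∈ range MM, wa i) * (∑ j ∈ range MM, wb j) / 2 ^ LL ≤ (2 ^ BB - 1) / 2 ^ LL :=
      Nat.div_le_div_right (Nat.le_sub_one_of_lt hchk')
    exact lt_of_le_of_lt (h1.trans h2) sizeStepF

/-- Checker step `InvC.step` of the kernel certificate for `8 < M_4500(F_{243/2000,13/20})` (statement and
proof verbatim from the Parity cell's `MaynardKernelH4500s.lean`, parity-ideate-p3 ROUND-18). [cite: Polymath8b2014, Theorem 6.7 (product test function), numerical instance k = 4500] -/
theorem InvC.step {a b Na Nb : ℕ} (ha : InvC a Na) (hb : InvC b Nb) (hchk : ssum Na * ssum Nb + 2 ^ LL ≤ 2 ^ BB) :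
    InvC (a + b) (stepC Na Nb) := by
  rcases ha with ⟨wa, hNa, hwa, hsa⟩
  rcases hb with ⟨wb, hNb, hwb, hsb⟩
  have hchk' : (∑ i ∈ range MM, wa i) * (∑ j ∈ range MM, wb j) + 2 ^ LL ≤ 2 ^ BB := by
    rw [hNa, hNb, ssum_kpack hsa, ssum_kpack hsb] at hchk; exact hchk
  refine ⟨fun m => (dconvNat wa wb m + 2 ^ LL - 1) / 2 ^ LL, ?_, ?_, ?_⟩
  · rw [hNa, hNb, stepC, trunc_eq, maskLo_eq, rndC_eq]; exact kpack_mul_step_ceil BB_pos hchk'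
  · exact dconvPow_add_le_ceilDiv pt_nonneg two_pow_LL_pos two_pow_LL_pos hwa hwb
  · have h1 := sum_ceilStep_le wa wb LL MM
    have h2 : (∑ i ∈ range MM, wa i) * (∑ j ∈ range MM, wb j) / 2 ^ LL + MM ≤ (2 ^ BB - 2 ^ LL) / 2 ^ LL + MM :=
      Nat.add_le_add_right (Nat.div_le_div_right (by omega)) MM
    exact lt_of_le_of_lt (h1.trans h2) sizeStepC

/-- Checker step `runF_sound` of the kernel certificate for `8 < M_4500(F_{243/2000,13/20})` (statement and
proof verbatim from the Parity cell's `MaynardKernelH4500s.lean`, parity-ideate-p3 ROUND-18). [cite: Polymath8b2014, Theorem 6.7 (product test function), numerical instance k = 4500] -/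
theorem runF_sound {x sx : ℕ} (hx : InvF 1 x) (hsx : ssum x = sx) :
    ∀ bs : List Bool, (runF x sx bs).2 = true → InvF (expo bs) (runF x sx bs).1
  | [], _ => by simpa [runF, expo] using hx
  | b :: bs, h => by
      have ih := runF_sound hx hsx bs
      cases b <;> simp only [runF, stepPairF, cond_true, cond_false, Bool.and_eq_true, Nat.blt_eq, pow2_eq] at h ⊢
      · obtain ⟨hok, hchk⟩ := h
        have h2 := (ih hok).step (ih hok) hchk
        simpa [expo, two_mul] using h2
      · obtain ⟨⟨hok, hchk⟩, hchk2⟩ := h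
        have h2 := (ih hok).step (ih hok) hchk
        have h3 := h2.step hx (by rw [hsx]; exact hchk2)
        simpa [expo, two_mul, add_assoc] using h3

/-- Checker step `runC_sound` of the kernel certificate for `8 < M_4500(F_{243/2000,13/20})` (statement and
proof verbatim from the Parity cell's `MaynardKernelH4500s.lean`, parity-ideate-p3 ROUND-18). [cite: Polymath8b2014, Theorem 6.7 (product test function), numerical instance k = 4500] -/
theorem runC_sound {x sx : ℕ} (hx : InvC 1 x) (hsx : ssum x = sx) :
    ∀ bs : List Bool, (runC x sx bs).2 = true → InvC (expo bs) (runC x sx bs).1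
  | [], _ => by simpa [runC, expo] using hx
  | b :: bs, h => by
      have ih := runC_sound hx hsx bs
      cases b <;> simp only [runC, stepPairC, cond_true, cond_false, Bool.and_eq_true, Nat.ble_eq, pow2_eq] at h ⊢
      · obtain ⟨hok, hchk⟩ := h
        have h2 := (ih hok).step (ih hok) hchk
        simpa [expo, two_mul] using h2
      · obtain ⟨⟨hok, hchk⟩, hchk2⟩ := h
        have h2 := (ih hok).step (ih hok) hchk
        have h3 := h2.step hx (by rw [hsx]; exact hchk2)
        simpa [expo, two_mul, add_assoc] using h3

/-! ## Reading the certificate -/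
/-- Checker step `cert_parts` of the kernel certificate for `8 < M_4500(F_{243/2000,13/20})` (statement and
proof verbatim from the Parity cell's `MaynardKernelH4500s.lean`, parity-ideate-p3 ROUND-18). [cite: Polymath8b2014, Theorem 6.7 (product test function), numerical instance k = 4500] -/
theorem cert_parts (h : cert = true) :
    resF.2 = true ∧ resC.2 = true ∧ sideOk = true ∧ Nat.ble T2 NUMSUM = true ∧ chk (sD + T1) (NUMSUM - T2) = true := by
  simp only [cert, Bool.and_eq_true] at h
  exact ⟨h.1.1.1, h.1.1.2, h.1.2, h.2.1, h.2.2⟩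

/-- Checker step `invF_final` of the kernel certificate for `8 < M_4500(F_{243/2000,13/20})` (statement and
proof verbatim from the Parity cell's `MaynardKernelH4500s.lean`, parity-ideate-p3 ROUND-18). [cite: Polymath8b2014, Theorem 6.7 (product test function), numerical instance k = 4500] -/
theorem invF_final (h : resF.2 = true) : InvF (nK + 1) NF := by
  rw [← expo_bitsF]; exact runF_sound invF_init rfl bitsF h
/-- Checker step `invC_final` of the kernel certificate for `8 < M_4500(F_{243/2000,13/20})` (statement and
proof verbatim from the Parity cell's `MaynardKernelH4500s.lean`, parity-ideate-p3 ROUND-18). [cite: Polymath8b2014, Theorem 6.7 (product test function), numerical instance k = 4500] -/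
theorem invC_final (h : resC.2 = true) : InvC (nK + 2) NC := by
  rw [← expo_bitsC]; exact runC_sound invC_init rfl bitsC h

/-- denominator: `Σ_{m<MD} pt^{∗k}_m ≤ sD / 2^L`.
[cite: Polymath8b2014, Theorem 6.7 (product test function), numerical instance k = 4500] -/
theorem den_le (h : resC.2 = true) :
    ∑ m ∈ range MD, dconvPow pt (nK + 2) m ≤ ((sD : ℕ) : ℝ) / ((2 ^ LL : ℕ) : ℝ) := by
  obtain ⟨w, hw, hle, hs⟩ := invC_final h
  have h1 : ∀ m < MD, dconvPow pt (nK + 2) m ≤ ((w m : ℕ) : ℝ) / ((2 ^ LL : ℕ) : ℝ) :=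
    fun m hm => hle m (lt_of_lt_of_le hm MD_le_MM)
  have h2 := sum_dconvPow_le_cast_div h1
  rwa [← psum_kpack hs MD_le_MM, ← hw] at h2

/-- splitting a packed vector: low part by a mask, high part by a shift.
[cite: Polymath8b2014, Theorem 6.7 (product test function), numerical instance k = 4500] -/
theorem kpack_low_high {P : ℕ} {w : ℕ → ℕ} (hd : ∀ j < P, w j < 2 ^ BB) :
    kpack BB (P + P) w &&& onesBelow (BB * P) = kpack BB P w ∧
      kpack BB (P + P) w >>> (BB * P) = kpack BB P (fun i => w (P + i)) := by
  have hlt : kpack BB P w < 2 ^ (BB * P) := kpack_lt hd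
  have hpos : 0 < 2 ^ (BB * P) := two_pow_pos' _
  rw [land_onesBelow, shiftRight_eq_div, kpack_add]
  refine ⟨?_, ?_⟩
  · rw [Nat.add_mul_mod_self_left, Nat.mod_eq_of_lt hlt]
  · rw [Nat.add_mul_div_left _ _ hpos, Nat.div_eq_of_lt hlt, zero_add]

/-- the binary-splitting block sums are the block sums.
[cite: Polymath8b2014, Theorem 6.7 (product test function), numerical instance k = 4500] -/
theorem nsGo_zero (o : ℕ) (w : ℕ → ℕ) (hs : ∑ t ∈ range WW, w t < 2 ^ BB - 1) :
    nsGo (kpack BB WW w) 0 o = ellT o ^ 2 * ∑ t ∈ range WW, w t := by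
  rw [nsGo, onesBelow_eq, kpack_mod_eq_sum hs]

/-- Checker step `nsGo_succ` of the kernel certificate for `8 < M_4500(F_{243/2000,13/20})` (statement and
proof verbatim from the Parity cell's `MaynardKernelH4500s.lean`, parity-ideate-p3 ROUND-18). [cite: Polymath8b2014, Theorem 6.7 (product test function), numerical instance k = 4500] -/
theorem nsGo_succ (d o : ℕ) (w : ℕ → ℕ) (hd : ∀ j < WW * 2 ^ d, w j < 2 ^ BB) :
    nsGo (kpack BB (WW * 2 ^ d + WW * 2 ^ d) w) (d + 1) o =
      nsGo (kpack BB (WW * 2 ^ d) w) d o + nsGo (kpack BB (WW * 2 ^ d) (fun i => w (WW * 2 ^ d + i))) d (o + 2 ^ d) := by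
  obtain ⟨hlo, hhi⟩ := kpack_low_high (P := WW * 2 ^ d) (w := w) hd
  rw [nsGo, hlo, hhi]

/-- Checker step `nsGo_eq` of the kernel certificate for `8 < M_4500(F_{243/2000,13/20})` (statement and
proof verbatim from the Parity cell's `MaynardKernelH4500s.lean`, parity-ideate-p3 ROUND-18). [cite: Polymath8b2014, Theorem 6.7 (product test function), numerical instance k = 4500] -/
theorem nsGo_eq : ∀ (d o : ℕ) (w : ℕ → ℕ), (∀ j < WW * 2 ^ d, w j < 2 ^ BB) →
    (∀ i < 2 ^ d, ∑ t ∈ range WW, w (i * WW + t) < 2 ^ BB - 1) →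
    nsGo (kpack BB (WW * 2 ^ d) w) d o = ∑ i ∈ range (2 ^ d), ellT (o + i) ^ 2 * ∑ t ∈ range WW, w (i * WW + t)
  | 0, o, w, hd, hs => by
      have h1 := hs 0 Nat.one_pos
      simp only [zero_mul, zero_add] at h1
      rw [pow_zero, Finset.sum_range_one, Nat.mul_one, nsGo_zero o w h1]
      simp only [add_zero, zero_mul, zero_add]
  | d + 1, o, w, hd, hs => by
      have hP : WW * 2 ^ (d + 1) = WW * 2 ^ d + WW * 2 ^ d := by rw [pow_succ]; ring
      have hd1 : ∀ j < WW * 2 ^ d, w j < 2 ^ BB := fun j hj => hd j (by rw [hP]; omega)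
      have hd2 : ∀ j < WW * 2 ^ d, (fun i => w (WW * 2 ^ d + i)) j < 2 ^ BB := fun j hj => hd _ (by rw [hP]; omega)
      have hidx : ∀ i t : ℕ, WW * 2 ^ d + (i * WW + t) = (2 ^ d + i) * WW + t := fun i t => by ring
      have hs1 : ∀ i < 2 ^ d, ∑ t ∈ range WW, w (i * WW + t) < 2 ^ BB - 1 :=
        fun i hi => hs i (by rw [pow_succ]; omega)
      have hs2 : ∀ i < 2 ^ d, ∑ t ∈ range WW, (fun i => w (WW * 2 ^ d + i)) (i * WW + t) < 2 ^ BB - 1 := by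
        intro i hi
        have := hs (2 ^ d + i) (by rw [pow_succ]; omega)
        simpa only [hidx] using this
      rw [hP, nsGo_succ d o w hd1, nsGo_eq d o w hd1 hs1, nsGo_eq d (o + 2 ^ d) _ hd2 hs2,
        show (2 : ℕ) ^ (d + 1) = 2 ^ d + 2 ^ d by rw [pow_succ]; ring, Finset.sum_range_add, add_right_inj]
      exact Finset.sum_congr rfl fun i _ => by simp only [hidx, add_assoc]

/-- Checker step `NUMSUM_eq` of the kernel certificate for `8 < M_4500(F_{243/2000,13/20})` (statement and
proof verbatim from the Parity cell's `MaynardKernelH4500s.lean`, parity-ideate-p3 ROUND-18). [cite: Polymath8b2014, Theorem 6.7 (product test function), numerical instance k = 4500] -/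
theorem NUMSUM_eq {w : ℕ → ℕ} (hw : NF = kpack BB MM w) (hs : ∑ m ∈ range MM, w m < 2 ^ BB - 1) :
    NUMSUM = ∑ m ∈ range MM, ellT (m / WW) ^ 2 * w m := by
  have hd := digits_lt hs
  have hblocks : ∑ m ∈ range MM, w m = ∑ i ∈ range rr, ∑ t ∈ range WW, w (i * WW + t) := by
    have := sum_range_mul_blockConst (fun _ => (1:ℕ)) w WW rr
    simpa only [one_mul, ← MM_eq] using this
  have hs' : ∀ i < 2 ^ (eE - Wexp), ∑ t ∈ range WW, w (i * WW + t) < 2 ^ BB - 1 := fun i hi =>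
    lt_of_le_of_lt (by
      rw [hblocks]
      exact Finset.single_le_sum (f := fun i => ∑ t ∈ range WW, w (i * WW + t)) (fun _ _ => Nat.zero_le _)
        (Finset.mem_range.2 hi)) hs
  rw [NUMSUM, hw, MM_eq', nsGo_eq (eE - Wexp) 0 w (by rw [← MM_eq']; exact hd) hs',
    show WW * 2 ^ (eE - Wexp) = rr * WW from Nat.mul_comm _ _, sum_range_mul_blockConst (fun i => ellT i ^ 2) w WW rr]
  exact Finset.sum_congr rfl fun i _ => by rw [zero_add]

/-! ## The log weights -/

/-- `Aa V / Aa 0 = (c + (k−1)·(V h)) / c`.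
[cite: Polymath8b2014, Theorem 6.7 (product test function), numerical instance k = 4500] -/
theorem Aa_ratio (V : ℕ) : ((Aa V : ℕ) : ℝ) / ((Aa 0 : ℕ) : ℝ) = (cR + ((nK : ℝ) + 1) * ((V : ℝ) * hR)) / cR := by
  unfold Aa cR hR; rw [kK_sub_one]
  have h1 : (0:ℝ) < cn := by exact_mod_cast param_pos.1
  have h2 : (0:ℝ) < cd := by exact_mod_cast param_pos.2.1
  have h5 : (0:ℝ) < N1 := N1_pos
  push_cast
  field_simp
  try ring

/-- Checker step `ellOf_sound` of the kernel certificate for `8 < M_4500(F_{243/2000,13/20})` (statement and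
proof verbatim from the Parity cell's `MaynardKernelH4500s.lean`, parity-ideate-p3 ROUND-18). [cite: Polymath8b2014, Theorem 6.7 (product test function), numerical instance k = 4500] -/
theorem ellOf_sound (V : ℕ) :
    0 ≤ (ellOf V : ℝ) ∧ (ellOf V : ℝ) / 2 ^ 80 ≤ Real.log ((cR + ((nK : ℝ) + 1) * ((V : ℝ) * hR)) / cR) := by
  refine ⟨Nat.cast_nonneg _, ?_⟩
  have hc := cR_pos; have hh := hR_pos
  have hx : 0 ≤ ((nK : ℝ) + 1) * ((V : ℝ) * hR) :=
    mul_nonneg (by positivity) (mul_nonneg (Nat.cast_nonneg V) hh.le)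
  have hge1 : 1 ≤ (cR + ((nK : ℝ) + 1) * ((V : ℝ) * hR)) / cR := by
    rw [le_div_iff₀ hc]; linarith
  have hlog0 : 0 ≤ Real.log ((cR + ((nK : ℝ) + 1) * ((V : ℝ) * hR)) / cR) := Real.log_nonneg hge1
  have hA : (0:ℝ) < (Aa V : ℝ) := by exact_mod_cast Aa_pos V
  have hA0 : (0:ℝ) < (Aa 0 : ℝ) := by exact_mod_cast Aa_pos 0
  cases h1 : logIv (Aa V) with
  | none => simp only [ellOf, h1, Nat.cast_zero, zero_div]; exact hlog0
  | some p =>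
    cases h2 : logIv (Aa 0) with
    | none => simp only [ellOf, h1, h2, Nat.cast_zero, zero_div]; exact hlog0
    | some q =>
      simp only [ellOf, h1, h2]
      obtain ⟨lo1, hi1⟩ := p
      obtain ⟨lo0, hi0⟩ := q
      have hs1 := (logIv_sound h1).1
      have hs2 := (logIv_sound h2).2
      by_cases hle : lo1 - hi0 ≤ 0
      · rw [Int.toNat_of_nonpos hle]; simp only [Nat.cast_zero, zero_div]; exact hlog0
      · have h0 : 0 ≤ lo1 - hi0 := by omega
        have hcast : ((Int.toNat (lo1 - hi0) : ℕ) : ℝ) = ((lo1 - hi0 : ℤ) : ℝ) := by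
          rw [← Int.cast_natCast, Int.toNat_of_nonneg h0]
        rw [hcast, ← Aa_ratio, Real.log_div hA.ne' hA0.ne']
        push_cast
        linarith

/-- geometry of the blocks (shifted by `δ = dP·h`): `V_{m/W}·h ≤ min(max(1 − ((m+k−1)h − δ), 0), T)`.
[cite: Polymath8b2014, Theorem 6.7 (product test function), numerical instance k = 4500] -/
theorem Vv_le (m : ℕ) :
    (Vv (m / WW) : ℝ) * hR ≤ min (max (1 - (((m + (nK + 1) : ℕ) : ℝ) * hR - (dP : ℝ) * hR)) 0) TR := by
  have hh := hR_pos
  have hW : 0 < WW := param_pos.2.2.2.2.2.1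
  refine le_min ?_ ?_
  · rcases Nat.eq_zero_or_pos (Vv (m / WW)) with h0 | hpos
    · rw [h0, Nat.cast_zero, zero_mul]; exact le_max_right _ _
    · have hV : Vv (m / WW) ≤ N1 + dP - ((m / WW + 1) * WW + kK - 2) := min_le_left _ _
      have hm : m < (m / WW + 1) * WW := by
        rw [Nat.mul_comm]; exact Nat.lt_mul_div_succ m hW
      have hsum : Vv (m / WW) + (m + (nK + 1)) ≤ N1 + dP := by unfold kK at hV; omega
      have h1 : ((Vv (m / WW) : ℕ) : ℝ) + ((m + (nK + 1) : ℕ) : ℝ) ≤ (N1 : ℝ) + (dP : ℝ) := by exact_mod_cast hsum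
      refine le_trans ?_ (le_max_left _ _)
      have key : (((Vv (m / WW) : ℕ) : ℝ) + ((m + (nK + 1) : ℕ) : ℝ) - (dP : ℝ)) * hR ≤ 1 := by
        unfold hR; rw [mul_one_div, div_le_one N1_pos]; linarith
      have e : (((Vv (m / WW) : ℕ) : ℝ) + ((m + (nK + 1) : ℕ) : ℝ) - (dP : ℝ)) * hR =
          ((Vv (m / WW) : ℕ) : ℝ) * hR + ((m + (nK + 1) : ℕ) : ℝ) * hR - (dP : ℝ) * hR := by ring
      linarith
  · rw [TR_eq]
    exact mul_le_mul_of_nonneg_right (by exact_mod_cast (min_le_right _ _ : Vv (m / WW) ≤ Jc)) hh.le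

/-- table read-off.
[cite: Polymath8b2014, Theorem 6.7 (product test function), numerical instance k = 4500] -/
theorem tabFn_lt (g : ℕ) : tabFn g < 2 ^ BT := by
  unfold tabFn; rw [onesBelow_eq]
  exact lt_of_le_of_lt (min_le_right _ _) (Nat.sub_lt (Nat.two_pow_pos _) Nat.one_pos)
/-- Checker step `tabDigit_eq` of the kernel certificate for `8 < M_4500(F_{243/2000,13/20})` (statement and
proof verbatim from the Parity cell's `MaynardKernelH4500s.lean`, parity-ideate-p3 ROUND-18). [cite: Polymath8b2014, Theorem 6.7 (product test function), numerical instance k = 4500] -/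
theorem tabDigit_eq {g : ℕ} (hg : g < 2 ^ eT) : tabDigit g = tabFn g := by
  have h : tabDigit g = kdigit BT TAB g := by
    rw [tabDigit, kdigit, land_onesBelow, shiftRight_eq_div]
  rw [h, TAB, kpackDC_zero_eq, kdigit_kpack (fun j _ => tabFn_lt j), if_pos hg]
/-- the used weight is below the exact-grid-point weight (quantisation down + clipping).
[cite: Polymath8b2014, Theorem 6.7 (product test function), numerical instance k = 4500] -/
theorem ellT_le (i : ℕ) : ellT i ≤ ellOf (Vv i / GG * GG) := by
  have hV : Vv i ≤ Jc := min_le_right _ _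
  have hg : Vv i / GG < 2 ^ eT := lt_of_le_of_lt (Nat.div_le_div_right hV) grid_ok
  rw [ellT, tabDigit_eq hg, tabFn]; exact min_le_left _ _

/-- the weight lower bound on block `m / W` (no `positivity`/`field_simp` here: hypotheses mentioning `ellOf`/`Vv`
make those tactics unfold the program).
[cite: Polymath8b2014, Theorem 6.7 (product test function), numerical instance k = 4500] -/
theorem weight_ge (m : ℕ) :
    ((ellT (m / WW) : ℝ) / 2 ^ 80 / ((nK : ℝ) + 1)) ^ 2 ≤
      (1 / ((nK : ℝ) + 1) *
        Real.log ((cR + ((nK : ℝ) + 1) * min (max (1 - (((m + (nK + 1) : ℕ) : ℝ) * hR - (dP : ℝ) * hR)) 0) TR) / cR)) ^ 2 := by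
  have hc := cR_pos; have hh := hR_pos
  have hn : (0 : ℝ) < (nK : ℝ) + 1 := Nat.cast_add_one_pos nK
  have h280 : (0 : ℝ) ≤ 1 / 2 ^ 80 := by norm_num
  have hVle := Vv_le m
  obtain ⟨h0, h1⟩ := ellOf_sound (Vv (m / WW) / GG * GG)
  have hV' : ((Vv (m / WW) / GG * GG : ℕ) : ℝ) ≤ (Vv (m / WW) : ℝ) := by exact_mod_cast Nat.div_mul_le_self _ _
  have hT : (ellT (m / WW) : ℝ) ≤ (ellOf (Vv (m / WW) / GG * GG) : ℝ) := by exact_mod_cast ellT_le _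
  have hx : 0 ≤ ((nK : ℝ) + 1) * (((Vv (m / WW) / GG * GG : ℕ) : ℝ) * hR) :=
    mul_nonneg hn.le (mul_nonneg (Nat.cast_nonneg _) hh.le)
  have harg : 0 < (cR + ((nK : ℝ) + 1) * (((Vv (m / WW) / GG * GG : ℕ) : ℝ) * hR)) / cR := div_pos (by linarith) hc
  have hmono : Real.log ((cR + ((nK : ℝ) + 1) * (((Vv (m / WW) / GG * GG : ℕ) : ℝ) * hR)) / cR) ≤
      Real.log ((cR + ((nK : ℝ) + 1) * min (max (1 - (((m + (nK + 1) : ℕ) : ℝ) * hR - (dP : ℝ) * hR)) 0) TR) / cR) := by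
    apply Real.log_le_log harg
    apply div_le_div_of_nonneg_right _ hc.le
    linarith [mul_le_mul_of_nonneg_left hVle hn.le, mul_le_mul_of_nonneg_left (mul_le_mul_of_nonneg_right hV' hh.le) hn.le]
  have hT' : (ellT (m / WW) : ℝ) / 2 ^ 80 ≤ (ellOf (Vv (m / WW) / GG * GG) : ℝ) / 2 ^ 80 := by
    rw [div_eq_mul_one_div, div_eq_mul_one_div ((ellOf _ : ℕ) : ℝ)]; exact mul_le_mul_of_nonneg_right hT h280
  have h2 : (ellT (m / WW) : ℝ) / 2 ^ 80 / ((nK : ℝ) + 1) ≤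
      1 / ((nK : ℝ) + 1) * Real.log ((cR + ((nK : ℝ) + 1) * min (max (1 - (((m + (nK + 1) : ℕ) : ℝ) * hR - (dP : ℝ) * hR)) 0) TR) / cR) := by
    rw [div_eq_mul_one_div _ ((nK:ℝ)+1), mul_comm]
    exact mul_le_mul_of_nonneg_left (hT'.trans (h1.trans hmono)) (one_div_pos.2 hn).le
  have h3 : 0 ≤ (ellT (m / WW) : ℝ) / 2 ^ 80 / ((nK : ℝ) + 1) := by
    rw [div_eq_mul_one_div ((ellT _ : ℕ) : ℝ)]
    exact div_nonneg (mul_nonneg (Nat.cast_nonneg _) h280) hn.le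
  exact pow_le_pow_left₀ h3 h2 2

/-- the algebra of one numerator term, over variables (keeps `field_simp` away from the program constants).
[cite: Polymath8b2014, Theorem 6.7 (product test function), numerical instance k = 4500] -/
theorem calc_aux (P S K E w : ℝ) (hS : S ≠ 0) (hK : K ≠ 0) :
    P / (S * 2 ^ 160 * K ^ 2) * (E ^ 2 * w) = (E / 2 ^ 80 / K) ^ 2 * (P * (w / S)) := by
  field_simp

/-! ## Assembly -/
/-- Checker step `dconvPow_pp` of the kernel certificate for `8 < M_4500(F_{243/2000,13/20})` (statement and
proof verbatim from the Parity cell's `MaynardKernelH4500s.lean`, parity-ideate-p3 ROUND-18). [cite: Polymath8b2014, Theorem 6.7 (product test function), numerical instance k = 4500] -/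
theorem dconvPow_pp (n m : ℕ) : dconvPow pp n m = m2R ^ n * dconvPow pt n m := by
  rw [show pp = fun j => m2R * pt j from funext pp_eq]; exact dconvPow_const_mul m2R pt n m

/-- Checker step `dconvPow_zero_slot` of the kernel certificate for `8 < M_4500(F_{243/2000,13/20})` (statement and
proof verbatim from the Parity cell's `MaynardKernelH4500s.lean`, parity-ideate-p3 ROUND-18). [cite: Polymath8b2014, Theorem 6.7 (product test function), numerical instance k = 4500] -/
theorem dconvPow_zero_slot (p : ℕ → ℝ) : ∀ n : ℕ, dconvPow p n 0 = p 0 ^ n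
  | 0 => by simp [dconvPow_zero]
  | n + 1 => by
      rw [dconvPow_succ, dconv, Finset.Nat.antidiagonal_zero, Finset.sum_singleton, dconvPow_zero_slot p n, pow_succ,
        mul_comm]

/-- Checker step `Jc_pos` of the kernel certificate for `8 < M_4500(F_{243/2000,13/20})` (statement and
proof verbatim from the Parity cell's `MaynardKernelH4500s.lean`, parity-ideate-p3 ROUND-18). [cite: Polymath8b2014, Theorem 6.7 (product test function), numerical instance k = 4500] -/
theorem Jc_pos : 0 < Jc := by decide
/-- Checker step `pt_zero_pos` of the kernel certificate for `8 < M_4500(F_{243/2000,13/20})` (statement and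
proof verbatim from the Parity cell's `MaynardKernelH4500s.lean`, parity-ideate-p3 ROUND-18). [cite: Polymath8b2014, Theorem 6.7 (product test function), numerical instance k = 4500] -/
theorem pt_zero_pos : 0 < pt 0 := by
  rw [pt_eq Jc_pos]
  have hN : 0 < NUM := by
    unfold NUM
    exact Nat.mul_pos (Nat.mul_pos param_pos.2.2.2.2.1 param_pos.1)
      (Nat.lt_of_lt_of_le (Nat.mul_pos param_pos.1 param_pos.2.2.2.1) (Nat.le_add_right _ _))
  exact div_pos (by exact_mod_cast hN) (by exact_mod_cast DEN_pos 0)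

/-- Checker step `m2R_mul` of the kernel certificate for `8 < M_4500(F_{243/2000,13/20})` (statement and
proof verbatim from the Parity cell's `MaynardKernelH4500s.lean`, parity-ideate-p3 ROUND-18). [cite: Polymath8b2014, Theorem 6.7 (product test function), numerical instance k = 4500] -/
theorem m2R_mul : m2R * ((cn : ℝ) * ((cn : ℝ) * Td + (cd : ℝ) * ((nK : ℝ) + 1) * Tn)) = (Tn : ℝ) * (cd : ℝ) ^ 2 := by
  unfold m2R cR TR
  have h1 : (0:ℝ) < cn := by exact_mod_cast param_pos.1
  have h2 : (0:ℝ) < cd := by exact_mod_cast param_pos.2.1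
  have h3 : (0:ℝ) < Tn := by exact_mod_cast param_pos.2.2.1
  have h4 : (0:ℝ) < Td := by exact_mod_cast param_pos.2.2.2.1
  have h5 : (0:ℝ) < (cn:ℝ) * Td + (cd:ℝ) * ((nK:ℝ) + 1) * Tn := by
    have : (0:ℝ) ≤ (cd:ℝ) * ((nK:ℝ) + 1) * Tn := by positivity
    nlinarith
  field_simp
  try ring

/-- Checker step `two_pow_160` of the kernel certificate for `8 < M_4500(F_{243/2000,13/20})` (statement and
proof verbatim from the Parity cell's `MaynardKernelH4500s.lean`, parity-ideate-p3 ROUND-18). [cite: Polymath8b2014, Theorem 6.7 (product test function), numerical instance k = 4500] -/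
theorem two_pow_160 : (1461501637330902918203684832716283019655932542976 : ℝ) = 2 ^ 160 := by norm_num
/-- the checker as a real inequality (generic in `D`, `N`).
[cite: Polymath8b2014, Theorem 6.7 (product test function), numerical instance k = 4500] -/
theorem chk_sound (D N : ℕ) (h : chk D N = true) :
    (thn : ℝ) * ((2:ℝ) ^ 160 * (((nK : ℝ) + 1) ^ 2 * ((Tn : ℝ) * ((cd : ℝ) ^ 2 * (D : ℝ))))) ≤
      (thd : ℝ) * (((nK : ℝ) + 2) * ((N : ℝ) * ((cn : ℝ) * ((cn : ℝ) * Td + (cd : ℝ) * ((nK : ℝ) + 1) * Tn)))) := by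
  have h1 := Nat.le_of_ble_eq_true h
  have h2 : ((thn * (2 ^ 160 * ((nK + 1) ^ 2 * (Tn * (cd ^ 2 * D)))) : ℕ) : ℝ) ≤
      ((thd * ((nK + 2) * (N * (cn * (cn * Td + cd * (nK + 1) * Tn)))) : ℕ) : ℝ) := by exact_mod_cast h1
  push_cast at h2
  first
    | exact h2
    | (rw [two_pow_160] at h2; exact h2)
/-- monotonicity of the checker in the two bounds (generic).
[cite: Polymath8b2014, Theorem 6.7 (product test function), numerical instance k = 4500] -/
theorem chk_mono {D D' N N' : ℕ} (hD : D ≤ D') (hN : N' ≤ N) (h : chk D' N' = true) : chk D N = true := by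
  unfold chk at h ⊢
  apply Nat.ble_eq_true_of_le
  have h1 := Nat.le_of_ble_eq_true h
  calc thn * (2 ^ 160 * ((nK + 1) ^ 2 * (Tn * (cd ^ 2 * D))))
      ≤ thn * (2 ^ 160 * ((nK + 1) ^ 2 * (Tn * (cd ^ 2 * D')))) := by gcongr
    _ ≤ thd * ((nK + 2) * (N' * (cn * (cn * Td + cd * (nK + 1) * Tn)))) := h1
    _ ≤ thd * ((nK + 2) * (N * (cn * (cn * Td + cd * (nK + 1) * Tn)))) := by gcongr

/-- the final arithmetic, over variables (keeps automation away from the big closed constants).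
[cite: Polymath8b2014, Theorem 6.7 (product test function), numerical instance k = 4500] -/
theorem ratio_arith (θn θd G K1 K2 xTn xcd xcn xTd xsD NS m2 S Mp DENOM NUMER : ℝ)
    (hS : 0 < S) (hG : 0 < G) (hK1 : 0 < K1) (hK2 : 0 ≤ K2) (_hm2 : 0 < m2) (hMp : 0 < Mp) (hθd : 0 < θd)
    (hθn : 0 ≤ θn) (hP : 0 < xcn * (xcn * xTd + xcd * K1 * xTn))
    (hm2P : m2 * (xcn * (xcn * xTd + xcd * K1 * xTn)) = xTn * xcd ^ 2)
    (hcert : θn * (G * (K1 ^ 2 * (xTn * (xcd ^ 2 * xsD)))) ≤ θd * (K2 * (NS * (xcn * (xcn * xTd + xcd * K1 * xTn)))))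
    (hDEN_le : DENOM ≤ Mp * m2 * (xsD / S)) (hDEN_pos : 0 < DENOM)
    (hNUM_ge : Mp / (S * G * K1 ^ 2) * NS ≤ NUMER) :
    θn / θd ≤ K2 * NUMER / DENOM := by
  have key : (θn * G * K1 ^ 2 * xsD * m2) * (xcn * (xcn * xTd + xcd * K1 * xTn)) ≤
      (θd * K2 * NS) * (xcn * (xcn * xTd + xcd * K1 * xTn)) := by
    have e1 : (θn * G * K1 ^ 2 * xsD * m2) * (xcn * (xcn * xTd + xcd * K1 * xTn)) =
        θn * (G * (K1 ^ 2 * ((m2 * (xcn * (xcn * xTd + xcd * K1 * xTn))) * xsD))) := by ring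
    rw [e1, hm2P]
    linarith [hcert]
  have key2 : θn * G * K1 ^ 2 * xsD * m2 ≤ θd * K2 * NS := le_of_mul_le_mul_right key hP
  have hQ : 0 < S * G * K1 ^ 2 := mul_pos (mul_pos hS hG) (pow_pos hK1 2)
  have key3 := mul_le_mul_of_nonneg_right key2 (le_of_lt (mul_pos hMp hS))
  have hfinal : θn * DENOM ≤ θd * (K2 * NUMER) := by
    calc θn * DENOM ≤ θn * (Mp * m2 * (xsD / S)) := mul_le_mul_of_nonneg_left hDEN_le hθn
      _ = (θn * Mp * m2 * xsD) / S := by ring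
      _ ≤ (θd * K2 * Mp * NS) / (S * G * K1 ^ 2) := by
          rw [div_le_div_iff₀ hS hQ]
          linarith [key3]
      _ = θd * (K2 * (Mp / (S * G * K1 ^ 2) * NS)) := by ring
      _ ≤ θd * (K2 * NUMER) := mul_le_mul_of_nonneg_left (mul_le_mul_of_nonneg_left hNUM_ge hK2) hθd.le
  rw [div_le_div_iff₀ hθd hDEN_pos]
  linarith [hfinal]

/-! ## ROUND-18: the Hoeffding pieces -/

/-! ### `SIG` = Σ j·leaf_j and the enclosure of `Σ_j j·pt_j` -/
/-- Checker step `sigGo_eq` of the kernel certificate for `8 < M_4500(F_{243/2000,13/20})` (statement and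
proof verbatim from the Parity cell's `MaynardKernelH4500s.lean`, parity-ideate-p3 ROUND-18). [cite: Polymath8b2014, Theorem 6.7 (product test function), numerical instance k = 4500] -/
theorem sigGo_eq : ∀ (d o : ℕ), sigGo d o = ∑ i ∈ range (2 ^ d), (o + i) * leaf (o + i)
  | 0, o => by rw [sigGo, pow_zero, Finset.sum_range_one, add_zero]
  | d + 1, o => by
      rw [sigGo, sigGo_eq d o, sigGo_eq d (o + 2 ^ d), show (2 : ℕ) ^ (d + 1) = 2 ^ d + 2 ^ d by rw [pow_succ]; ring,
        Finset.sum_range_add]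
      simp only [add_assoc]

/-- Checker step `SIG_eq` of the kernel certificate for `8 < M_4500(F_{243/2000,13/20})` (statement and
proof verbatim from the Parity cell's `MaynardKernelH4500s.lean`, parity-ideate-p3 ROUND-18). [cite: Polymath8b2014, Theorem 6.7 (product test function), numerical instance k = 4500] -/
theorem SIG_eq : SIG = ∑ j ∈ range MM, j * leaf j := by
  rw [SIG, sigGo_eq, MM]; simp only [zero_add]

/-- sums of functions vanishing from `Jc` on do not see the range beyond `Jc`.
[cite: Polymath8b2014, Theorem 6.7 (product test function), numerical instance k = 4500] -/
theorem sum_range_of_vanish {β : Type*} [AddCommMonoid β] (f : ℕ → β) (hf : ∀ j, Jc ≤ j → f j = 0) {A : ℕ}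
    (hA : Jc ≤ A) : ∑ j ∈ range A, f j = ∑ j ∈ range Jc, f j := by
  symm
  apply Finset.sum_subset (fun x hx => Finset.mem_range.2 (lt_of_lt_of_le (Finset.mem_range.1 hx) hA))
  intro j _ hj
  exact hf j (not_lt.1 fun h' => hj (Finset.mem_range.2 h'))

/-- Checker step `sum_j_ind` of the kernel certificate for `8 < M_4500(F_{243/2000,13/20})` (statement and
proof verbatim from the Parity cell's `MaynardKernelH4500s.lean`, parity-ideate-p3 ROUND-18). [cite: Polymath8b2014, Theorem 6.7 (product test function), numerical instance k = 4500] -/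
theorem sum_j_ind : ∑ j ∈ range MM, j * ind j = TRI := by
  rw [TRI, sum_range_of_vanish (fun j => j * ind j) (fun j hj => by simp [ind, not_lt.2 hj]) Jc_lt_MM.le,
    ← Finset.sum_range_id]
  exact Finset.sum_congr rfl fun j hj => by rw [Finset.mem_range] at hj; simp [ind, hj]

/-! KERNEL RULE K6 (ROUND-18): a generic algebraic lemma (`Finset.sum_add_distrib`, …) instantiated at `ℕ` carries instance terms
that differ syntactically from `ℕ`'s core ones; when the kernel compares the two `HAdd.hAdd` nodes it unfolds both to `Nat.add x y`
and `reduce_nat` then WHNF-EVALUATES the closed arguments — fatal for `SIG`/sums over `range M`.  So all bookkeeping with heavy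
closed naturals is done in `ℝ` on cast atoms, with `ℕ`-specific cast lemmas only. -/
/-- Checker step `SIG_cast` of the kernel certificate for `8 < M_4500(F_{243/2000,13/20})` (statement and
proof verbatim from the Parity cell's `MaynardKernelH4500s.lean`, parity-ideate-p3 ROUND-18). [cite: Polymath8b2014, Theorem 6.7 (product test function), numerical instance k = 4500] -/
theorem SIG_cast : (SIG : ℝ) = ∑ j ∈ range MM, (j : ℝ) * (leaf j : ℝ) := by
  rw [SIG_eq, Nat.cast_sum]; exact Finset.sum_congr rfl fun j _ => by rw [Nat.cast_mul]

/-- Checker step `TRI_cast` of the kernel certificate for `8 < M_4500(F_{243/2000,13/20})` (statement and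
proof verbatim from the Parity cell's `MaynardKernelH4500s.lean`, parity-ideate-p3 ROUND-18). [cite: Polymath8b2014, Theorem 6.7 (product test function), numerical instance k = 4500] -/
theorem TRI_cast : (TRI : ℝ) = ∑ j ∈ range MM, (j : ℝ) * (ind j : ℝ) := by
  rw [← sum_j_ind, Nat.cast_sum]; exact Finset.sum_congr rfl fun j _ => by rw [Nat.cast_mul]

/-- the real quantity enclosed: `PT1 = Σ_{j<M} j·pt_j`. [folklore] -/
def PT1 : ℝ := ∑ j ∈ range MM, (j : ℝ) * pt j

/-- Checker step `cast_two_pow_LL` of the kernel certificate for `8 < M_4500(F_{243/2000,13/20})` (statement and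
proof verbatim from the Parity cell's `MaynardKernelH4500s.lean`, parity-ideate-p3 ROUND-18). [cite: Polymath8b2014, Theorem 6.7 (product test function), numerical instance k = 4500] -/
theorem cast_two_pow_LL : ((2 ^ LL : ℕ) : ℝ) = (2 : ℝ) ^ LL := by push_cast; ring

/-- Checker step `SIG_le` of the kernel certificate for `8 < M_4500(F_{243/2000,13/20})` (statement and
proof verbatim from the Parity cell's `MaynardKernelH4500s.lean`, parity-ideate-p3 ROUND-18). [cite: Polymath8b2014, Theorem 6.7 (product test function), numerical instance k = 4500] -/
theorem SIG_le : (SIG : ℝ) ≤ (2 : ℝ) ^ LL * PT1 := by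
  rw [SIG_eq, Nat.cast_sum, PT1, Finset.mul_sum]
  refine Finset.sum_le_sum fun j _ => ?_
  have h1 := leaf_div_le j
  rw [cast_two_pow_LL, div_le_iff₀ (pow_pos two_pos _)] at h1
  rw [Nat.cast_mul]
  have hj : (0 : ℝ) ≤ (j : ℝ) := Nat.cast_nonneg j
  nlinarith

/-- Checker step `PT1_le` of the kernel certificate for `8 < M_4500(F_{243/2000,13/20})` (statement and
proof verbatim from the Parity cell's `MaynardKernelH4500s.lean`, parity-ideate-p3 ROUND-18). [cite: Polymath8b2014, Theorem 6.7 (product test function), numerical instance k = 4500] -/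
theorem PT1_le : (2 : ℝ) ^ LL * PT1 ≤ (SIG : ℝ) + (TRI : ℝ) := by
  rw [SIG_cast, TRI_cast, ← Finset.sum_add_distrib, PT1, Finset.mul_sum]
  refine Finset.sum_le_sum fun j _ => ?_
  have h1 := le_uu_div j
  rw [cast_two_pow_LL, le_div_iff₀ (pow_pos two_pos _), uu, Nat.cast_add] at h1
  have hj : (0 : ℝ) ≤ (j : ℝ) := Nat.cast_nonneg j
  nlinarith

/-! ### the two-sided log enclosure -/
/-- Checker plumbing `LOGr`: an exact-integer constant / function of the ROUND-18 kernel certificate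
(see the module docstring; verbatim from the Parity cell's `MaynardKernelH4500s.lean`). [folklore] -/
def LOGr : ℝ := Real.log ((cR + ((nK : ℝ) + 1) * TR) / cR)

/-- Checker step `LOGr_eq_log_div` of the kernel certificate for `8 < M_4500(F_{243/2000,13/20})` (statement and
proof verbatim from the Parity cell's `MaynardKernelH4500s.lean`, parity-ideate-p3 ROUND-18). [cite: Polymath8b2014, Theorem 6.7 (product test function), numerical instance k = 4500] -/
theorem LOGr_eq_log_div : LOGr = Real.log ((Aa Jc : ℕ) : ℝ) - Real.log ((Aa 0 : ℕ) : ℝ) := by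
  have hA : (0:ℝ) < (Aa Jc : ℝ) := by exact_mod_cast Aa_pos Jc
  have hA0 : (0:ℝ) < (Aa 0 : ℝ) := by exact_mod_cast Aa_pos 0
  rw [LOGr, ← Real.log_div hA.ne' hA0.ne', Aa_ratio, ← TR_eq]

/-- Checker step `LOGr_nonneg` of the kernel certificate for `8 < M_4500(F_{243/2000,13/20})` (statement and
proof verbatim from the Parity cell's `MaynardKernelH4500s.lean`, parity-ideate-p3 ROUND-18). [cite: Polymath8b2014, Theorem 6.7 (product test function), numerical instance k = 4500] -/
theorem LOGr_nonneg : 0 ≤ LOGr := by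
  have hc := cR_pos; have hT := TR_pos
  have hx : 0 ≤ ((nK : ℝ) + 1) * TR := by positivity
  apply Real.log_nonneg
  rw [le_div_iff₀ hc]; linarith

/-- Checker step `log_enclosure` of the kernel certificate for `8 < M_4500(F_{243/2000,13/20})` (statement and
proof verbatim from the Parity cell's `MaynardKernelH4500s.lean`, parity-ideate-p3 ROUND-18). [cite: Polymath8b2014, Theorem 6.7 (product test function), numerical instance k = 4500] -/
theorem log_enclosure (h : logOk = true) :
    (LOGLO : ℝ) ≤ 2 ^ 80 * LOGr ∧ 2 ^ 80 * LOGr ≤ (LOGHI : ℝ) := by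
  have hL := LOGr_nonneg
  cases h1 : logIv (Aa Jc) with
  | none => simp [logOk, h1] at h
  | some p =>
    cases h2 : logIv (Aa 0) with
    | none => simp [logOk, h2] at h
    | some q =>
      obtain ⟨lo1, hi1⟩ := p
      obtain ⟨lo0, hi0⟩ := q
      have hs1 := logIv_sound h1
      have hs2 := logIv_sound h2
      have e := LOGr_eq_log_div
      simp only [LOGLO, LOGHI, h1, h2]
      refine ⟨?_, ?_⟩
      · by_cases hle : lo1 - hi0 ≤ 0
        · rw [Int.toNat_of_nonpos hle]; simp only [Nat.cast_zero]; linarith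
        · have h0 : 0 ≤ lo1 - hi0 := by omega
          have hcast : ((Int.toNat (lo1 - hi0) : ℕ) : ℝ) = ((lo1 - hi0 : ℤ) : ℝ) := by
            rw [← Int.cast_natCast, Int.toNat_of_nonneg h0]
          rw [hcast]; push_cast; linarith [hs1.1, hs2.2]
      · have hge : (2:ℝ) ^ 80 * LOGr ≤ ((hi1 - lo0 : ℤ) : ℝ) := by push_cast; linarith [hs1.2, hs2.1]
        have h0r : (0:ℝ) ≤ ((hi1 - lo0 : ℤ) : ℝ) := le_trans (by positivity) hge
        have h0 : 0 ≤ hi1 - lo0 := by exact_mod_cast h0r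
        have hcast : ((Int.toNat (hi1 - lo0) : ℕ) : ℝ) = ((hi1 - lo0 : ℤ) : ℝ) := by
          rw [← Int.cast_natCast, Int.toNat_of_nonneg h0]
        rw [hcast]; exact hge

/-! ### the Hoeffding tails in integers -/
/-- `e^{−t} ≤ (n/(n+t))^n` for `t ≥ 0`, from `1 + x ≤ e^x`.
[cite: Polymath8b2014, Theorem 6.7 (product test function), numerical instance k = 4500] -/
theorem exp_neg_le_pow (t : ℝ) (ht : 0 ≤ t) (n : ℕ) (hn : 0 < n) :
    Real.exp (-t) ≤ ((n : ℝ) / ((n : ℝ) + t)) ^ n := by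
  have hn' : (0 : ℝ) < n := by exact_mod_cast hn
  have h1 : (1 + t / n) ^ n ≤ Real.exp t := by
    have h2 : 1 + t / n ≤ Real.exp (t / n) := by linarith [Real.add_one_le_exp (t / n)]
    calc (1 + t / n) ^ n ≤ Real.exp (t / n) ^ n := pow_le_pow_left₀ (by positivity) h2 n
      _ = Real.exp t := by rw [← Real.exp_nat_mul]; congr 1; field_simp
  have h3 : 0 < (1 + t / n) ^ n := by positivity
  have h4 : ((n : ℝ) / ((n : ℝ) + t)) ^ n = ((1 + t / n) ^ n)⁻¹ := by
    rw [← inv_pow]; congr 1; field_simp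
  rw [h4, Real.exp_neg]
  exact inv_anti₀ h3 h1

/-- ceiling division property.
[cite: Polymath8b2014, Theorem 6.7 (product test function), numerical instance k = 4500] -/
theorem le_ceilDiv_mul (x b : ℕ) (hb : 0 < b) : x ≤ (x + b - 1) / b * b := by
  have := Nat.lt_div_mul_add (a := x + b - 1) hb
  omega

/-- Checker step `tail_arith` of the kernel certificate for `8 < M_4500(F_{243/2000,13/20})` (statement and
proof verbatim from the Parity cell's `MaynardKernelH4500s.lean`, parity-ideate-p3 ROUND-18). [cite: Polymath8b2014, Theorem 6.7 (product test function), numerical instance k = 4500] -/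
theorem tail_arith (S A B e : ℝ) (hB : 0 < B) (he : e ≤ A / B) {T : ℝ} (hT : S * A ≤ T * B) (hS : 0 ≤ S) :
    S * e ≤ T := by
  have h1 : S * e ≤ S * (A / B) := mul_le_mul_of_nonneg_left he hS
  have h3 : S * (A / B) ≤ T := by rw [← mul_div_assoc, div_le_iff₀ hB]; exact hT
  linarith

/-- Checker step `exp_arg` of the kernel certificate for `8 < M_4500(F_{243/2000,13/20})` (statement and
proof verbatim from the Parity cell's `MaynardKernelH4500s.lean`, parity-ideate-p3 ROUND-18). [cite: Polymath8b2014, Theorem 6.7 (product test function), numerical instance k = 4500] -/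
theorem exp_arg (K : ℝ) (hK : 0 < K) :
    -2 * ((Lam : ℝ) * hR) ^ 2 / (K * hR ^ 2) = -(2 * (Lam : ℝ) ^ 2 / K) := by
  have hh := hR_pos
  field_simp

/-- Checker step `pow_ratio` of the kernel certificate for `8 < M_4500(F_{243/2000,13/20})` (statement and
proof verbatim from the Parity cell's `MaynardKernelH4500s.lean`, parity-ideate-p3 ROUND-18). [cite: Polymath8b2014, Theorem 6.7 (product test function), numerical instance k = 4500] -/
theorem pow_ratio (K : ℝ) (hK : 0 < K) :
    ((nE : ℝ) / ((nE : ℝ) + 2 * (Lam : ℝ) ^ 2 / K)) ^ nE =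
      (((nE : ℝ) * K) ^ nE) / (((nE : ℝ) * K + 2 * (Lam : ℝ) ^ 2) ^ nE) := by
  rw [← div_pow]; congr 1; field_simp

/-- `2^L · e^{−2λ₁²/(k h²)} ≤ T1`.
[cite: Polymath8b2014, Theorem 6.7 (product test function), numerical instance k = 4500] -/
theorem T1_ge : (2 : ℝ) ^ LL * Real.exp (-2 * ((Lam : ℝ) * hR) ^ 2 / (((nK : ℝ) + 2) * hR ^ 2)) ≤ (T1 : ℝ) := by
  have hK : (0 : ℝ) < (nK : ℝ) + 2 := by positivity
  rw [exp_arg _ hK]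
  have ht : 0 ≤ 2 * (Lam : ℝ) ^ 2 / ((nK : ℝ) + 2) := by positivity
  have h1 := exp_neg_le_pow _ ht nE nE_pos
  rw [pow_ratio _ hK] at h1
  have hb : 0 < b1 := b1_pos
  have h2 : 2 ^ LL * a1 ≤ T1 * b1 := le_ceilDiv_mul _ _ hb
  have h3 : ((2 ^ LL * a1 : ℕ) : ℝ) ≤ ((T1 * b1 : ℕ) : ℝ) := by exact_mod_cast h2
  have hA : ((a1 : ℕ) : ℝ) = ((nE : ℝ) * ((nK : ℝ) + 2)) ^ nE := by unfold a1; push_cast; ring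
  have hB : ((b1 : ℕ) : ℝ) = ((nE : ℝ) * ((nK : ℝ) + 2) + 2 * (Lam : ℝ) ^ 2) ^ nE := by unfold b1; push_cast; ring
  have hnE : (0 : ℝ) < (nE : ℝ) := by exact_mod_cast nE_pos
  have hBpos : (0 : ℝ) < ((nE : ℝ) * ((nK : ℝ) + 2) + 2 * (Lam : ℝ) ^ 2) ^ nE := by positivity
  refine tail_arith ((2:ℝ) ^ LL) _ _ _ hBpos h1 ?_ (by positivity)
  rw [← hA, ← hB]; push_cast at h3 ⊢; linarith

/-- `2^L · (2^80 LOG)² · e^{−2λ₂²/((k−1) h²)} ≤ t2` for any `lh ≥ 2^80 LOG` and `t2` with the ceiling property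
(variables: the closed constants `LOGHI`, `T2` must never be touched by cast normalisation — it would evaluate `logIv`).
[cite: Polymath8b2014, Theorem 6.7 (product test function), numerical instance k = 4500] -/
theorem T2_ge_aux (lh t2 : ℕ) (h2 : 2 ^ LL * lh ^ 2 * a2 ≤ t2 * b2) (hhi : 2 ^ 80 * LOGr ≤ (lh : ℝ)) :
    (2 : ℝ) ^ LL * (2 ^ 80 * LOGr) ^ 2 * Real.exp (-2 * ((Lam : ℝ) * hR) ^ 2 / (((nK : ℝ) + 1) * hR ^ 2)) ≤ (t2 : ℝ) := by
  have hK : (0 : ℝ) < (nK : ℝ) + 1 := by positivity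
  rw [exp_arg _ hK]
  have ht : 0 ≤ 2 * (Lam : ℝ) ^ 2 / ((nK : ℝ) + 1) := by positivity
  have h1 := exp_neg_le_pow _ ht nE nE_pos
  rw [pow_ratio _ hK] at h1
  have h3 : ((2 ^ LL * lh ^ 2 * a2 : ℕ) : ℝ) ≤ ((t2 * b2 : ℕ) : ℝ) := by exact_mod_cast h2
  have hA : ((a2 : ℕ) : ℝ) = ((nE : ℝ) * ((nK : ℝ) + 1)) ^ nE := by unfold a2; push_cast; ring
  have hB : ((b2 : ℕ) : ℝ) = ((nE : ℝ) * ((nK : ℝ) + 1) + 2 * (Lam : ℝ) ^ 2) ^ nE := by unfold b2; push_cast; ring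
  have hnE : (0 : ℝ) < (nE : ℝ) := by exact_mod_cast nE_pos
  have hBpos : (0 : ℝ) < ((nE : ℝ) * ((nK : ℝ) + 1) + 2 * (Lam : ℝ) ^ 2) ^ nE := by positivity
  have hL := LOGr_nonneg
  have hsq : (2 ^ 80 * LOGr) ^ 2 ≤ (lh : ℝ) ^ 2 := pow_le_pow_left₀ (by positivity) hhi 2
  have h4 : (2 : ℝ) ^ LL * (2 ^ 80 * LOGr) ^ 2 * Real.exp (-(2 * (Lam : ℝ) ^ 2 / ((nK : ℝ) + 1))) ≤
      (2 : ℝ) ^ LL * (lh : ℝ) ^ 2 * Real.exp (-(2 * (Lam : ℝ) ^ 2 / ((nK : ℝ) + 1))) :=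
    mul_le_mul_of_nonneg_right (mul_le_mul_of_nonneg_left hsq (by positivity)) (Real.exp_pos _).le
  refine le_trans h4 (tail_arith ((2:ℝ) ^ LL * (lh : ℝ) ^ 2) _ _ _ hBpos h1 ?_ (by positivity))
  rw [← hA, ← hB]; push_cast at h3 ⊢; linarith

/-- KERNEL/ELABORATOR RULE (ROUND-17 K2, sharpened): a defeq test between `T2 * b2` and its delta-unfolding makes `Meta.whnf`
evaluate `LOGHI` (hence `logIv`) by term reduction — so unfold by the equation lemma first, then match syntactically.
[cite: Polymath8b2014, Theorem 6.7 (product test function), numerical instance k = 4500] -/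
theorem T2_mul_ge : 2 ^ LL * LOGHI ^ 2 * a2 ≤ T2 * b2 := by
  rw [T2]
  exact le_ceilDiv_mul _ _ b2_pos

/-- Checker step `T2_ge` of the kernel certificate for `8 < M_4500(F_{243/2000,13/20})` (statement and
proof verbatim from the Parity cell's `MaynardKernelH4500s.lean`, parity-ideate-p3 ROUND-18). [cite: Polymath8b2014, Theorem 6.7 (product test function), numerical instance k = 4500] -/
theorem T2_ge (hS : logOk = true) :
    (2 : ℝ) ^ LL * (2 ^ 80 * LOGr) ^ 2 * Real.exp (-2 * ((Lam : ℝ) * hR) ^ 2 / (((nK : ℝ) + 1) * hR ^ 2)) ≤ (T2 : ℝ) := by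
  have hhi : 2 ^ 80 * LOGr ≤ (LOGHI : ℝ) := (log_enclosure hS).2
  have key := T2_ge_aux LOGHI T2 T2_mul_ge hhi
  exact key

/-! ### the side conditions as real inequalities (arithmetic over variables) -/
/-- Checker step `eexpr_arith` of the kernel certificate for `8 < M_4500(F_{243/2000,13/20})` (statement and
proof verbatim from the Parity cell's `MaynardKernelH4500s.lean`, parity-ideate-p3 ROUND-18). [cite: Polymath8b2014, Theorem 6.7 (product test function), numerical instance k = 4500] -/
theorem eexpr_arith (K1 c T xcn xcd xTn xTd ℓ PT h : ℝ) (hc : c = xcn / xcd) (hT : T = xTn / xTd)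
    (h1 : 0 < xcn) (h2 : 0 < xcd) (h3 : 0 < xTn) (h4 : 0 < xTd) (hK : 0 < K1) :
    (1 / K1 ^ 2 * (ℓ - K1 * T / (c + K1 * T)) - h * ((T / (c * (c + K1 * T))) * PT)) / (T / (c * (c + K1 * T))) =
      xcn * (xcn * xTd + xcd * K1 * xTn) * ℓ / (xcd ^ 2 * xTn * K1 ^ 2) - xcn / (xcd * K1) - h * PT := by
  subst hc hT
  have h5 : 0 < xcn / xcd + K1 * (xTn / xTd) := by positivity
  field_simp

/-- Checker step `cond1_arith` of the kernel certificate for `8 < M_4500(F_{243/2000,13/20})` (statement and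
proof verbatim from the Parity cell's `MaynardKernelH4500s.lean`, parity-ideate-p3 ROUND-18). [cite: Polymath8b2014, Theorem 6.7 (product test function), numerical instance k = 4500] -/
theorem cond1_arith (K1 K2 xcn xcd xTn xTd N1r S P ℓ PT lo sgh Mr L : ℝ)
    (hK1 : 0 < K1) (hK2 : 0 ≤ K2) (h1 : 0 < xcn) (h2 : 0 < xcd) (h3 : 0 < xTn) (h4 : 0 < xTd) (hN : 0 < N1r)
    (hS : 0 < S) (hP : 0 < P) (hlo : lo ≤ P * ℓ) (hsg : S * PT ≤ sgh)
    (hineq : (N1r + L) * (S * P * xcd ^ 2 * xTn * K1 ^ 2) + K2 * (N1r * xcn * S * P * xcd * xTn * K1 + sgh * (P * xcd ^ 2 * xTn * K1 ^ 2)) ≤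
      Mr * (S * P * xcd ^ 2 * xTn * K1 ^ 2) + K2 * N1r * (xcn * (xcn * xTd + xcd * K1 * xTn)) * lo * S) :
    (1 - Mr * (1 / N1r)) + L * (1 / N1r) ≤
      K2 * (xcn * (xcn * xTd + xcd * K1 * xTn) * ℓ / (xcd ^ 2 * xTn * K1 ^ 2) - xcn / (xcd * K1) - (1 / N1r) * PT) := by
  set D := S * P * xcd ^ 2 * xTn * K1 ^ 2 with hD
  set X := xcn * (xcn * xTd + xcd * K1 * xTn) with hX
  have hDpos : 0 < D := by positivity
  have hXpos : 0 < X := by positivity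
  have m1 : K2 * N1r * X * lo * S ≤ K2 * N1r * X * (P * ℓ) * S := by
    have : 0 ≤ K2 * N1r * X * S := by positivity
    nlinarith
  have m2 : K2 * (N1r * xcn * S * P * xcd * xTn * K1 + (S * PT) * (P * xcd ^ 2 * xTn * K1 ^ 2)) ≤
      K2 * (N1r * xcn * S * P * xcd * xTn * K1 + sgh * (P * xcd ^ 2 * xTn * K1 ^ 2)) := by
    have : 0 ≤ K2 * (P * xcd ^ 2 * xTn * K1 ^ 2) := by positivity
    nlinarith
  have star : (N1r + L) * D + K2 * (N1r * xcn * S * P * xcd * xTn * K1 + (S * PT) * (P * xcd ^ 2 * xTn * K1 ^ 2)) ≤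
      Mr * D + K2 * N1r * X * (P * ℓ) * S := by linarith
  have key : K2 * (X * ℓ / (xcd ^ 2 * xTn * K1 ^ 2) - xcn / (xcd * K1) - (1 / N1r) * PT) - ((1 - Mr * (1 / N1r)) + L * (1 / N1r)) =
      ((Mr * D + K2 * N1r * X * (P * ℓ) * S) -
        ((N1r + L) * D + K2 * (N1r * xcn * S * P * xcd * xTn * K1 + (S * PT) * (P * xcd ^ 2 * xTn * K1 ^ 2)))) / (N1r * D) := by
    rw [hD]
    field_simp
    ring
  have hnn : 0 ≤ ((Mr * D + K2 * N1r * X * (P * ℓ) * S) -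
        ((N1r + L) * D + K2 * (N1r * xcn * S * P * xcd * xTn * K1 + (S * PT) * (P * xcd ^ 2 * xTn * K1 ^ 2)))) / (N1r * D) :=
    div_nonneg (sub_nonneg.2 star) (by positivity)
  linarith

/-- Checker step `cond2_arith` of the kernel certificate for `8 < M_4500(F_{243/2000,13/20})` (statement and
proof verbatim from the Parity cell's `MaynardKernelH4500s.lean`, parity-ideate-p3 ROUND-18). [cite: Polymath8b2014, Theorem 6.7 (product test function), numerical instance k = 4500] -/
theorem cond2_arith (K1 xcn xcd xTn xTd N1r S P ℓ PT hi sg dPr L : ℝ)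
    (hK1 : 0 < K1) (h1 : 0 < xcn) (h2 : 0 < xcd) (h3 : 0 < xTn) (h4 : 0 < xTd) (hN : 0 < N1r)
    (hS : 0 < S) (hP : 0 < P) (hhi : P * ℓ ≤ hi) (hsg : sg ≤ S * PT) (_hX0 : 0 ≤ ℓ)
    (hineq : (dPr + L) * (S * P * xcd ^ 2 * xTn * K1 ^ 2) + K1 * N1r * (xcn * (xcn * xTd + xcd * K1 * xTn)) * hi * S ≤
      K1 * (S * P * xcd ^ 2 * xTn * K1 ^ 2) + K1 * (N1r * xcn * S * P * xcd * xTn * K1 + sg * (P * xcd ^ 2 * xTn * K1 ^ 2))) :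
    dPr * (1 / N1r) + L * (1 / N1r) ≤
      K1 * (1 / N1r - (xcn * (xcn * xTd + xcd * K1 * xTn) * ℓ / (xcd ^ 2 * xTn * K1 ^ 2) - xcn / (xcd * K1) - (1 / N1r) * PT)) := by
  set D := S * P * xcd ^ 2 * xTn * K1 ^ 2 with hD
  set X := xcn * (xcn * xTd + xcd * K1 * xTn) with hX
  have hDpos : 0 < D := by positivity
  have hXpos : 0 < X := by positivity
  have m1 : K1 * N1r * X * (P * ℓ) * S ≤ K1 * N1r * X * hi * S := by
    have : 0 ≤ K1 * N1r * X * S := by positivity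
    nlinarith
  have m2 : K1 * (N1r * xcn * S * P * xcd * xTn * K1 + sg * (P * xcd ^ 2 * xTn * K1 ^ 2)) ≤
      K1 * (N1r * xcn * S * P * xcd * xTn * K1 + (S * PT) * (P * xcd ^ 2 * xTn * K1 ^ 2)) := by
    have : 0 ≤ K1 * (P * xcd ^ 2 * xTn * K1 ^ 2) := by positivity
    nlinarith
  have star : (dPr + L) * D + K1 * N1r * X * (P * ℓ) * S ≤
      K1 * D + K1 * (N1r * xcn * S * P * xcd * xTn * K1 + (S * PT) * (P * xcd ^ 2 * xTn * K1 ^ 2)) := by linarith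
  have key : K1 * (1 / N1r - (X * ℓ / (xcd ^ 2 * xTn * K1 ^ 2) - xcn / (xcd * K1) - (1 / N1r) * PT)) - (dPr * (1 / N1r) + L * (1 / N1r)) =
      ((K1 * D + K1 * (N1r * xcn * S * P * xcd * xTn * K1 + (S * PT) * (P * xcd ^ 2 * xTn * K1 ^ 2))) -
        ((dPr + L) * D + K1 * N1r * X * (P * ℓ) * S)) / (N1r * D) := by
    rw [hD]
    field_simp
    ring
  have hnn : 0 ≤ ((K1 * D + K1 * (N1r * xcn * S * P * xcd * xTn * K1 + (S * PT) * (P * xcd ^ 2 * xTn * K1 ^ 2))) -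
        ((dPr + L) * D + K1 * N1r * X * (P * ℓ) * S)) / (N1r * D) :=
    div_nonneg (sub_nonneg.2 star) (by positivity)
  linarith

/-! ### the E₁-expression of the Hoeffding theorem at our parameters -/
/-- Checker plumbing `Esum`: an exact-integer constant / function of the ROUND-18 kernel certificate
(see the module docstring; verbatim from the Parity cell's `MaynardKernelH4500s.lean`). [folklore] -/
def Esum : ℝ := ∑ j ∈ range (Jc + 1), (j : ℝ) * cellMass (fun t => polymathProfile (nK + 2) cR TR t ^ 2) hR j
/-- Checker plumbing `Eexpr`: an exact-integer constant / function of the ROUND-18 kernel certificate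
(see the module docstring; verbatim from the Parity cell's `MaynardKernelH4500s.lean`). [folklore] -/
def Eexpr : ℝ :=
  (1 / ((nK : ℝ) + 1) ^ 2 * (LOGr - ((nK : ℝ) + 1) * TR / (cR + ((nK : ℝ) + 1) * TR)) - hR * Esum) /
    (TR / (cR * (cR + ((nK : ℝ) + 1) * TR)))

/-- Checker step `Esum_eq` of the kernel certificate for `8 < M_4500(F_{243/2000,13/20})` (statement and
proof verbatim from the Parity cell's `MaynardKernelH4500s.lean`, parity-ideate-p3 ROUND-18). [cite: Polymath8b2014, Theorem 6.7 (product test function), numerical instance k = 4500] -/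
theorem Esum_eq : Esum = m2R * PT1 := by
  rw [Esum, PT1, Finset.mul_sum]
  have hv : ∀ j, Jc ≤ j → (j : ℝ) * pp j = 0 := fun j hj => by
    rw [pp_eq, pt_eq_zero hj, mul_zero, mul_zero]
  rw [show (fun j : ℕ => (j : ℝ) * cellMass (fun t => polymathProfile (nK + 2) cR TR t ^ 2) hR j) = fun j : ℕ => (j : ℝ) * pp j
      from rfl, sum_range_of_vanish _ hv (Nat.le_succ Jc), ← sum_range_of_vanish _ hv Jc_lt_MM.le]
  exact Finset.sum_congr rfl fun j _ => by rw [pp_eq]; ring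

/-- Checker step `Eexpr_eq` of the kernel certificate for `8 < M_4500(F_{243/2000,13/20})` (statement and
proof verbatim from the Parity cell's `MaynardKernelH4500s.lean`, parity-ideate-p3 ROUND-18). [cite: Polymath8b2014, Theorem 6.7 (product test function), numerical instance k = 4500] -/
theorem Eexpr_eq : Eexpr = (X1 : ℝ) * LOGr / ((cd : ℝ) ^ 2 * Tn * ((nK : ℝ) + 1) ^ 2) - (cn : ℝ) / ((cd : ℝ) * ((nK : ℝ) + 1)) - hR * PT1 := by
  have h1 : (0:ℝ) < cn := by exact_mod_cast param_pos.1
  have h2 : (0:ℝ) < cd := by exact_mod_cast param_pos.2.1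
  have h3 : (0:ℝ) < Tn := by exact_mod_cast param_pos.2.2.1
  have h4 : (0:ℝ) < Td := by exact_mod_cast param_pos.2.2.2.1
  have hK : (0:ℝ) < (nK : ℝ) + 1 := by positivity
  rw [Eexpr, Esum_eq, show m2R = TR / (cR * (cR + ((nK : ℝ) + 1) * TR)) from rfl,
    eexpr_arith ((nK : ℝ) + 1) cR TR cn cd Tn Td LOGr PT1 hR rfl rfl h1 h2 h3 h4 hK, X1]
  push_cast
  ring

/-- Checker step `sideOk_parts` of the kernel certificate for `8 < M_4500(F_{243/2000,13/20})` (statement and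
proof verbatim from the Parity cell's `MaynardKernelH4500s.lean`, parity-ideate-p3 ROUND-18). [cite: Polymath8b2014, Theorem 6.7 (product test function), numerical instance k = 4500] -/
theorem sideOk_parts (h : sideOk = true) : logOk = true ∧ chk1 LOGLO SIG = true ∧ chk2 LOGHI SIG = true := by
  simp only [sideOk, Bool.and_eq_true] at h
  exact ⟨h.1, h.2.1, h.2.2⟩

/-- Checker step `chk1_cast` of the kernel certificate for `8 < M_4500(F_{243/2000,13/20})` (statement and
proof verbatim from the Parity cell's `MaynardKernelH4500s.lean`, parity-ideate-p3 ROUND-18). [cite: Polymath8b2014, Theorem 6.7 (product test function), numerical instance k = 4500] -/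
theorem chk1_cast (lo sg : ℕ) (h : chk1 lo sg = true) :
    (((N1 : ℝ) + Lam) * ((2:ℝ) ^ LL * 2 ^ 80 * (cd : ℝ) ^ 2 * Tn * ((nK : ℝ) + 1) ^ 2) +
      ((nK : ℝ) + 2) * ((N1 : ℝ) * cn * 2 ^ LL * 2 ^ 80 * cd * Tn * ((nK : ℝ) + 1) + ((sg : ℝ) + (TRI : ℝ)) * (2 ^ 80 * (cd : ℝ) ^ 2 * Tn * ((nK : ℝ) + 1) ^ 2))) ≤
      (MD : ℝ) * ((2:ℝ) ^ LL * 2 ^ 80 * (cd : ℝ) ^ 2 * Tn * ((nK : ℝ) + 1) ^ 2) +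
        ((nK : ℝ) + 2) * N1 * ((cn : ℝ) * ((cn : ℝ) * Td + (cd : ℝ) * ((nK : ℝ) + 1) * Tn)) * (lo : ℝ) * 2 ^ LL := by
  have h1 := Nat.le_of_ble_eq_true h
  have h2 : ((((N1 + Lam) * DDc + (nK + 2) * (C1c + (sg + TRI) * Y1c)) : ℕ) : ℝ) ≤
      (((MD * DDc + (nK + 2) * N1 * X1 * lo * 2 ^ LL) : ℕ) : ℝ) := by exact_mod_cast h1
  unfold DDc C1c Y1c X1 at h2
  push_cast at h2
  linarith

/-- Checker step `chk2_cast` of the kernel certificate for `8 < M_4500(F_{243/2000,13/20})` (statement and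
proof verbatim from the Parity cell's `MaynardKernelH4500s.lean`, parity-ideate-p3 ROUND-18). [cite: Polymath8b2014, Theorem 6.7 (product test function), numerical instance k = 4500] -/
theorem chk2_cast (hi sg : ℕ) (h : chk2 hi sg = true) :
    (((dP : ℝ) + Lam) * ((2:ℝ) ^ LL * 2 ^ 80 * (cd : ℝ) ^ 2 * Tn * ((nK : ℝ) + 1) ^ 2) +
      ((nK : ℝ) + 1) * N1 * ((cn : ℝ) * ((cn : ℝ) * Td + (cd : ℝ) * ((nK : ℝ) + 1) * Tn)) * (hi : ℝ) * 2 ^ LL) ≤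
      ((nK : ℝ) + 1) * ((2:ℝ) ^ LL * 2 ^ 80 * (cd : ℝ) ^ 2 * Tn * ((nK : ℝ) + 1) ^ 2) +
        ((nK : ℝ) + 1) * ((N1 : ℝ) * cn * 2 ^ LL * 2 ^ 80 * cd * Tn * ((nK : ℝ) + 1) + (sg : ℝ) * (2 ^ 80 * (cd : ℝ) ^ 2 * Tn * ((nK : ℝ) + 1) ^ 2)) := by
  have h1 := Nat.le_of_ble_eq_true h
  have h2 : ((((dP + Lam) * DDc + (nK + 1) * N1 * X1 * hi * 2 ^ LL) : ℕ) : ℝ) ≤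
      ((((nK + 1) * DDc + (nK + 1) * (C1c + sg * Y1c)) : ℕ) : ℝ) := by exact_mod_cast h1
  unfold DDc C1c Y1c X1 at h2
  push_cast at h2
  linarith

/-- `hcond₁` of the Hoeffding theorem from `sideOk`.
[cite: Polymath8b2014, Theorem 6.7 (product test function), numerical instance k = 4500] -/
theorem hcond1_real (hS : sideOk = true) :
    (1 - ((mstar : ℝ) + 1) * hR) + (Lam : ℝ) * hR ≤ ((nK : ℝ) + 2) * Eexpr := by
  obtain ⟨hlog, hc1, -⟩ := sideOk_parts hS
  have h1 : (0:ℝ) < cn := by exact_mod_cast param_pos.1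
  have h2 : (0:ℝ) < cd := by exact_mod_cast param_pos.2.1
  have h3 : (0:ℝ) < Tn := by exact_mod_cast param_pos.2.2.1
  have h4 : (0:ℝ) < Td := by exact_mod_cast param_pos.2.2.2.1
  have hK : (0:ℝ) < (nK : ℝ) + 1 := by positivity
  have hK2 : (0:ℝ) ≤ (nK : ℝ) + 2 := by positivity
  have hineq := chk1_cast LOGLO SIG hc1
  have hMD : (MD : ℝ) = (mstar : ℝ) + 1 := by unfold MD; push_cast; ring
  rw [hMD] at hineq
  obtain ⟨hlo, -⟩ := log_enclosure hlog
  have key := cond1_arith ((nK : ℝ) + 1) ((nK : ℝ) + 2) cn cd Tn Td N1 ((2:ℝ) ^ LL) ((2:ℝ) ^ 80) LOGr PT1 LOGLO ((SIG : ℝ) + (TRI : ℝ))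
    ((mstar : ℝ) + 1) Lam hK hK2 h1 h2 h3 h4 N1_pos (by positivity) (by positivity) hlo PT1_le hineq
  rw [Eexpr_eq, X1]; unfold hR; push_cast
  linarith [key]

/-- `hcond₂` of the Hoeffding theorem from `sideOk`.
[cite: Polymath8b2014, Theorem 6.7 (product test function), numerical instance k = 4500] -/
theorem hcond2_real (hS : sideOk = true) :
    (dP : ℝ) * hR + (Lam : ℝ) * hR ≤ ((nK : ℝ) + 1) * (hR - Eexpr) := by
  obtain ⟨hlog, -, hc2⟩ := sideOk_parts hS
  have h1 : (0:ℝ) < cn := by exact_mod_cast param_pos.1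
  have h2 : (0:ℝ) < cd := by exact_mod_cast param_pos.2.1
  have h3 : (0:ℝ) < Tn := by exact_mod_cast param_pos.2.2.1
  have h4 : (0:ℝ) < Td := by exact_mod_cast param_pos.2.2.2.1
  have hK : (0:ℝ) < (nK : ℝ) + 1 := by positivity
  have hineq := chk2_cast LOGHI SIG hc2
  obtain ⟨-, hhi⟩ := log_enclosure hlog
  have key := cond2_arith ((nK : ℝ) + 1) cn cd Tn Td N1 ((2:ℝ) ^ LL) ((2:ℝ) ^ 80) LOGr PT1 LOGHI SIG (dP : ℝ) Lam
    hK h1 h2 h3 h4 N1_pos (by positivity) (by positivity) hhi SIG_le LOGr_nonneg hineq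
  rw [Eexpr_eq, X1]; unfold hR; push_cast
  linarith [key]

/-! ### weights and the total mass of `G` -/
/-- Checker step `two_le_kK` of the kernel certificate for `8 < M_4500(F_{243/2000,13/20})` (statement and
proof verbatim from the Parity cell's `MaynardKernelH4500s.lean`, parity-ideate-p3 ROUND-18). [cite: Polymath8b2014, Theorem 6.7 (product test function), numerical instance k = 4500] -/
theorem two_le_kK : 2 ≤ nK + 2 := by omega

/-- Checker step `weight_geH` of the kernel certificate for `8 < M_4500(F_{243/2000,13/20})` (statement and
proof verbatim from the Parity cell's `MaynardKernelH4500s.lean`, parity-ideate-p3 ROUND-18). [cite: Polymath8b2014, Theorem 6.7 (product test function), numerical instance k = 4500] -/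
theorem weight_geH (m : ℕ) :
    ((ellT (m / WW) : ℝ) / 2 ^ 80 / ((nK : ℝ) + 1)) ^ 2 ≤
      (∫ u in Ioc 0 (1 - ((((m + (nK + 1) : ℕ) : ℝ)) * hR - (dP : ℝ) * hR)), polymathProfile (nK + 2) cR TR u) ^ 2 := by
  rw [setIntegral_Ioc_polymathProfile two_le_kK cR_pos TR_pos, cast_kK_sub_one]
  exact weight_ge m

/-- Checker step `GT_eq` of the kernel certificate for `8 < M_4500(F_{243/2000,13/20})` (statement and
proof verbatim from the Parity cell's `MaynardKernelH4500s.lean`, parity-ideate-p3 ROUND-18). [cite: Polymath8b2014, Theorem 6.7 (product test function), numerical instance k = 4500] -/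
theorem GT_eq : (∫ u in Ioc 0 TR, polymathProfile (nK + 2) cR TR u) = 1 / ((nK : ℝ) + 1) * LOGr := by
  rw [setIntegral_Ioc_polymathProfile two_le_kK cR_pos TR_pos, cast_kK_sub_one, max_eq_left TR_pos.le, min_self, LOGr]

/-- Checker step `hJcH` of the kernel certificate for `8 < M_4500(F_{243/2000,13/20})` (statement and
proof verbatim from the Parity cell's `MaynardKernelH4500s.lean`, parity-ideate-p3 ROUND-18). [cite: Polymath8b2014, Theorem 6.7 (product test function), numerical instance k = 4500] -/
theorem hJcH : TR < ((Jc + 1 : ℕ) : ℝ) * hR := by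
  rw [TR_eq]; push_cast; linarith [hR_pos]

/-! ## Assembly (Hoeffding) -/
/-- soundness from the parts: two chain checks, the side conditions, `T2 ≤ NUMSUM` and the final inequality on
`(sD + T1, NUMSUM − T2)` (closed program constants appear only as atoms / in syntactically identical positions).
[cite: Polymath8b2014, Theorem 6.7 (product test function), numerical instance k = 4500] -/
theorem theta_le_of_partsH (hF : resF.2 = true) (hC : resC.2 = true) (hS : sideOk = true) (hT2le : T2 ≤ NUMSUM)
    (hchk : chk (sD + T1) (NUMSUM - T2) = true) :
    (thn : ℝ) / thd ≤ maynardFunctional (nK + 2) (productTestFn (nK + 2) (polymathProfile (nK + 2) cR TR)) := by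
  have hc := cR_pos; have hT := TR_pos; have hh := hR_pos; have hm2 := m2R_pos
  have hlam : 0 ≤ (Lam : ℝ) * hR := mul_nonneg (Nat.cast_nonneg _) hh.le
  have hlog := (sideOk_parts hS).1
  have hc1 : (1 - ((mstar : ℝ) + 1) * hR) + (Lam : ℝ) * hR ≤ ((nK : ℝ) + 2) * Eexpr := hcond1_real hS
  have hc2 : (dP : ℝ) * hR + (Lam : ℝ) * hR ≤ ((nK : ℝ) + 1) * (hR - Eexpr) := hcond2_real hS
  have hmain := maynardFunctional_polymathProfile_ge_hoeffdingRatio nK hc hT hh hJcH mstar MM ((dP : ℝ) * hR) hlam hlam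
    hc1 hc2
  refine le_trans ?_ hmain
  have hS2 : (0:ℝ) < ((2 ^ LL : ℕ) : ℝ) := by exact_mod_cast two_pow_LL_pos
  have hK1 : (0:ℝ) < (nK : ℝ) + 1 := Nat.cast_add_one_pos nK
  have hG : (0:ℝ) < (2:ℝ) ^ 160 := pow_pos two_pos 160
  have hm2def : TR / (cR * (cR + ((nK : ℝ) + 1) * TR)) = m2R := rfl
  -- the denominator
  set DENOM := ∑ m ∈ range (mstar + 1), dconvPow (cellMass (fun t => polymathProfile (nK + 2) cR TR t ^ 2) hR) (nK + 2) m +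
      (TR / (cR * (cR + ((nK : ℝ) + 1) * TR))) ^ (nK + 2) * Real.exp (-2 * ((Lam : ℝ) * hR) ^ 2 / (((nK : ℝ) + 2) * hR ^ 2))
    with hDENOM
  have hDEN_eq : ∑ m ∈ range (mstar + 1), dconvPow (cellMass (fun t => polymathProfile (nK + 2) cR TR t ^ 2) hR) (nK + 2) m =
      m2R ^ (nK + 2) * ∑ m ∈ range MD, dconvPow pt (nK + 2) m := by
    rw [show mstar + 1 = MD from rfl, Finset.mul_sum]; exact Finset.sum_congr rfl fun m _ => dconvPow_pp (nK + 2) m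
  have hxsD : (((sD + T1 : ℕ)) : ℝ) = (sD : ℝ) + (T1 : ℝ) := Nat.cast_add _ _
  have hDEN_le : DENOM ≤ m2R ^ (nK + 1) * m2R * ((((sD + T1 : ℕ)) : ℝ) / ((2 ^ LL : ℕ) : ℝ)) := by
    rw [hDENOM, hDEN_eq, hm2def, hxsD, ← pow_succ, add_div, mul_add]
    apply add_le_add
    · exact mul_le_mul_of_nonneg_left (den_le hC) (pow_pos hm2 _).le
    · refine mul_le_mul_of_nonneg_left ?_ (pow_pos hm2 _).le
      rw [le_div_iff₀ hS2, cast_two_pow_LL, mul_comm]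
      exact T1_ge
  have hDEN_pos : 0 < DENOM := by
    rw [hDENOM, hDEN_eq, hm2def]
    refine add_pos_of_nonneg_of_pos ?_ (mul_pos (pow_pos hm2 _) (Real.exp_pos _))
    exact mul_nonneg (pow_pos hm2 _).le (Finset.sum_nonneg fun m _ => dconvPow_nonneg pt_nonneg _ _)
  -- the numerator
  set NUMER := ∑ m ∈ range MM, (∫ u in Ioc 0 (1 - ((((m + (nK + 1) : ℕ) : ℝ)) * hR - (dP : ℝ) * hR)),
        polymathProfile (nK + 2) cR TR u) ^ 2 *
      dconvPow (cellMass (fun t => polymathProfile (nK + 2) cR TR t ^ 2) hR) (nK + 1) m -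
      (∫ u in Ioc 0 TR, polymathProfile (nK + 2) cR TR u) ^ 2 *
        ((TR / (cR * (cR + ((nK : ℝ) + 1) * TR))) ^ (nK + 1) * Real.exp (-2 * ((Lam : ℝ) * hR) ^ 2 / (((nK : ℝ) + 1) * hR ^ 2)))
    with hNUMER
  obtain ⟨w, hw, hle, hs⟩ := invF_final hF
  have hNUM1 : m2R ^ (nK + 1) / (((2 ^ LL : ℕ) : ℝ) * 2 ^ 160 * ((nK : ℝ) + 1) ^ 2) * (NUMSUM : ℝ) ≤
      ∑ m ∈ range MM, (∫ u in Ioc 0 (1 - ((((m + (nK + 1) : ℕ) : ℝ)) * hR - (dP : ℝ) * hR)),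
        polymathProfile (nK + 2) cR TR u) ^ 2 *
      dconvPow (cellMass (fun t => polymathProfile (nK + 2) cR TR t ^ 2) hR) (nK + 1) m := by
    rw [NUMSUM_eq hw hs, Nat.cast_sum, Finset.mul_sum]
    refine Finset.sum_le_sum fun m hm => ?_
    rw [Finset.mem_range] at hm
    have h1 := weight_geH m
    have h2 : m2R ^ (nK + 1) * (((w m : ℕ) : ℝ) / ((2 ^ LL : ℕ) : ℝ)) ≤
        dconvPow (cellMass (fun t => polymathProfile (nK + 2) cR TR t ^ 2) hR) (nK + 1) m := by
      rw [show cellMass (fun t => polymathProfile (nK + 2) cR TR t ^ 2) hR = pp from rfl, dconvPow_pp]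
      exact mul_le_mul_of_nonneg_left (hle m hm) (pow_pos hm2 _).le
    have h3 : 0 ≤ ((ellT (m / WW) : ℝ) / 2 ^ 80 / ((nK : ℝ) + 1)) ^ 2 := sq_nonneg _
    have h4 : 0 ≤ m2R ^ (nK + 1) * (((w m : ℕ) : ℝ) / ((2 ^ LL : ℕ) : ℝ)) :=
      mul_nonneg (pow_pos hm2 _).le (div_nonneg (Nat.cast_nonneg _) hS2.le)
    calc m2R ^ (nK + 1) / (((2 ^ LL : ℕ) : ℝ) * 2 ^ 160 * ((nK : ℝ) + 1) ^ 2) * (((ellT (m / WW) ^ 2 * w m : ℕ)) : ℝ)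
        = ((ellT (m / WW) : ℝ) / 2 ^ 80 / ((nK : ℝ) + 1)) ^ 2 *
            (m2R ^ (nK + 1) * (((w m : ℕ) : ℝ) / ((2 ^ LL : ℕ) : ℝ))) := by
          rw [Nat.cast_mul, Nat.cast_pow (ellT (m / WW)) 2]
          exact calc_aux _ _ _ _ _ hS2.ne' hK1.ne'
      _ ≤ _ := mul_le_mul h1 h2 h4 (le_trans h3 h1)
  clear hle hs hw
  have hNS : (((NUMSUM - T2 : ℕ)) : ℝ) = (NUMSUM : ℝ) - (T2 : ℝ) := Nat.cast_sub hT2le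
  have hcoef : 0 ≤ m2R ^ (nK + 1) / (((2 ^ LL : ℕ) : ℝ) * 2 ^ 160 * ((nK : ℝ) + 1) ^ 2) :=
    div_nonneg (pow_pos hm2 _).le (mul_pos (mul_pos hS2 hG) (pow_pos hK1 2)).le
  have htail : (∫ u in Ioc 0 TR, polymathProfile (nK + 2) cR TR u) ^ 2 *
        ((TR / (cR * (cR + ((nK : ℝ) + 1) * TR))) ^ (nK + 1) * Real.exp (-2 * ((Lam : ℝ) * hR) ^ 2 / (((nK : ℝ) + 1) * hR ^ 2))) ≤
      m2R ^ (nK + 1) / (((2 ^ LL : ℕ) : ℝ) * 2 ^ 160 * ((nK : ℝ) + 1) ^ 2) * (T2 : ℝ) := by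
    have hT2r := T2_ge hlog
    have hpos : 0 < m2R ^ (nK + 1) := pow_pos hm2 _
    have e1 : (1 / ((nK : ℝ) + 1) * LOGr) ^ 2 * (m2R ^ (nK + 1) * Real.exp (-2 * ((Lam : ℝ) * hR) ^ 2 / (((nK : ℝ) + 1) * hR ^ 2))) =
        m2R ^ (nK + 1) / ((2:ℝ) ^ LL * 2 ^ 160 * ((nK : ℝ) + 1) ^ 2) *
          ((2:ℝ) ^ LL * (2 ^ 80 * LOGr) ^ 2 * Real.exp (-2 * ((Lam : ℝ) * hR) ^ 2 / (((nK : ℝ) + 1) * hR ^ 2))) := by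
      field_simp
    rw [GT_eq, hm2def, cast_two_pow_LL, e1]
    rw [cast_two_pow_LL] at hcoef
    exact mul_le_mul_of_nonneg_left hT2r hcoef
  have hNUM_ge : m2R ^ (nK + 1) / (((2 ^ LL : ℕ) : ℝ) * 2 ^ 160 * ((nK : ℝ) + 1) ^ 2) * (((NUMSUM - T2 : ℕ)) : ℝ) ≤ NUMER := by
    rw [hNS, hNUMER, mul_sub]
    linarith [hNUM1, htail]
  -- the certified integer inequality, as reals
  have hR := chk_sound (sD + T1) (NUMSUM - T2) hchk
  have hthd : (0:ℝ) < thd := by exact_mod_cast param_pos.2.2.2.2.2.2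
  have h1 : (0:ℝ) < cn := by exact_mod_cast param_pos.1
  have h2 : (0:ℝ) < cd := by exact_mod_cast param_pos.2.1
  have h3 : (0:ℝ) < Tn := by exact_mod_cast param_pos.2.2.1
  have h4 : (0:ℝ) < Td := by exact_mod_cast param_pos.2.2.2.1
  have hPpos : (0:ℝ) < (cn : ℝ) * ((cn : ℝ) * Td + (cd : ℝ) * ((nK : ℝ) + 1) * Tn) := by
    apply mul_pos h1
    have : (0:ℝ) ≤ (cd : ℝ) * ((nK : ℝ) + 1) * Tn := mul_nonneg (mul_nonneg h2.le hK1.le) h3.le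
    linarith [mul_pos h1 h4]
  exact ratio_arith (thn : ℝ) (thd : ℝ) ((2:ℝ) ^ 160) ((nK : ℝ) + 1) ((nK : ℝ) + 2) (Tn : ℝ) (cd : ℝ) (cn : ℝ) (Td : ℝ)
    ((((sD + T1 : ℕ)) : ℝ)) ((((NUMSUM - T2 : ℕ)) : ℝ)) m2R (((2 ^ LL : ℕ) : ℝ)) (m2R ^ (nK + 1)) DENOM NUMER hS2 hG hK1
    (add_nonneg (Nat.cast_nonneg _) zero_le_two) hm2 (pow_pos hm2 _) hthd (Nat.cast_nonneg _) hPpos m2R_mul hR hDEN_le hDEN_pos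
    hNUM_ge

/-- soundness of the one-piece certificate.
[cite: Polymath8b2014, Theorem 6.7 (product test function), numerical instance k = 4500] -/
theorem theta_le_maynardFunctional (h : cert = true) :
    (thn : ℝ) / thd ≤ maynardFunctional (nK + 2) (productTestFn (nK + 2) (polymathProfile (nK + 2) cR TR)) := by
  obtain ⟨hF, hC, hS, hT2, hchk⟩ := cert_parts h
  exact theta_le_of_partsH hF hC hS (Nat.le_of_ble_eq_true hT2) hchk

/-- soundness of the SPLIT certificate: chain checks + side conditions + decided literal bounds `nlb ≤ NUMSUM`, `sD ≤ dub`,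
`T2 ≤ nlb` and the final inequality on `(dub + T1, nlb − T2)` — all combined by ℕ-monotonicity of `chk` (no casts of
closed constants).
[cite: Polymath8b2014, Theorem 6.7 (product test function), numerical instance k = 4500] -/
theorem theta_le_of_boundsH (nlb dub : ℕ) (hF : resF.2 = true) (hC : resC.2 = true) (hS : sideOk = true)
    (hn : Nat.ble nlb NUMSUM = true) (hd : Nat.ble sD dub = true) (hT2 : Nat.ble T2 nlb = true)
    (hineq : chk (dub + T1) (nlb - T2) = true) :
    (thn : ℝ) / thd ≤ maynardFunctional (nK + 2) (productTestFn (nK + 2) (polymathProfile (nK + 2) cR TR)) :=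
  theta_le_of_partsH hF hC hS (le_trans (Nat.le_of_ble_eq_true hT2) (Nat.le_of_ble_eq_true hn))
    (chk_mono (Nat.add_le_add_right (Nat.le_of_ble_eq_true hd) T1)
      (Nat.sub_le_sub_right (Nat.le_of_ble_eq_true hn) T2) hineq)

/-- the SPLIT certificate in the exact shape of the four kernel-decided facts `okF okC okS okI` of an instance file
(use as `theta_le_of_factsH _ _ okF okC okS okI`; the Bool splitting happens here, over variables — ROUND-18 K7).
[cite: Polymath8b2014, Theorem 6.7 (product test function), numerical instance k = 4500] -/
theorem theta_le_of_factsH (nlb dub : ℕ) (okF : FactF nlb = true) (okC : FactC dub = true) (okS : sideOk = true)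
    (okI : FactI nlb dub = true) :
    (thn : ℝ) / thd ≤ maynardFunctional (nK + 2) (productTestFn (nK + 2) (polymathProfile (nK + 2) cR TR)) := by
  rw [FactF, Bool.and_eq_true] at okF
  rw [FactC, Bool.and_eq_true] at okC
  rw [FactI, Bool.and_eq_true] at okI
  exact theta_le_of_boundsH nlb dub okF.1 okC.1 okS okF.2 okC.2 okI.1 okI.2

end

end Literature.NumberTheory.Sieve.MaynardTao.ProductKernelCert

/-! ## The kernel run (ROUND-18 «KERNEL-M4500-H»: k = 4500, c = 243/2000, T = 13/20, N1 = 2·10^5 (h = 5·10^{-6}), M = 2^18,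
L = 48, B = 100, W = 2^4, log-table grid 127, Hoeffding recentring m* = 198069, dP = 2068, Λ₁ = Λ₂ = 250 cells, θ = 801/100).
Engine prediction (python mirror kcert18.py, kit job j310553): cert = true, k·(N⁻−tail)/(D⁺+tail) ≈ 8.10. -/
namespace Literature.NumberTheory.Sieve.MaynardTao.ProductKernelCert

-- kernel evaluation 1/4: the floor chain, block sums and log table, with the numerator lower bound.
set_option maxHeartbeats 0 in
/-- Checker step `okF` of the kernel certificate for `8 < M_4500(F_{243/2000,13/20})` (statement and
proof verbatim from the Parity cell's `MaynardKernelH4500s.lean`, parity-ideate-p3 ROUND-18). [cite: Polymath8b2014, Theorem 6.7 (product test function), numerical instance k = 4500] -/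
theorem okF : FactF 11811056310428251732669910094690917832478506769950723840056431648 = true := by decide +kernel
-- kernel evaluation 2/4: the ceil chain with the denominator upper bound (partial sum below m* + 1).
set_option maxHeartbeats 0 in
/-- Checker step `okC` of the kernel certificate for `8 < M_4500(F_{243/2000,13/20})` (statement and
proof verbatim from the Parity cell's `MaynardKernelH4500s.lean`, parity-ideate-p3 ROUND-18). [cite: Polymath8b2014, Theorem 6.7 (product test function), numerical instance k = 4500] -/
theorem okC : FactC 121259393890130 = true := by decide +kernel
-- kernel evaluation 3/4: the Hoeffding side conditions (log enclosure, Σ j·leaf_j, hcond₁, hcond₂).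
set_option maxHeartbeats 0 in
/-- Checker step `okS` of the kernel certificate for `8 < M_4500(F_{243/2000,13/20})` (statement and
proof verbatim from the Parity cell's `MaynardKernelH4500s.lean`, parity-ideate-p3 ROUND-18). [cite: Polymath8b2014, Theorem 6.7 (product test function), numerical instance k = 4500] -/
theorem okS : sideOk = true := by decide +kernel
-- kernel evaluation 4/4: the tails and the final integer inequality on the two literal bounds.
set_option maxHeartbeats 0 in
/-- Checker step `okI` of the kernel certificate for `8 < M_4500(F_{243/2000,13/20})` (statement and
proof verbatim from the Parity cell's `MaynardKernelH4500s.lean`, parity-ideate-p3 ROUND-18). [cite: Polymath8b2014, Theorem 6.7 (product test function), numerical instance k = 4500] -/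
theorem okI : FactI 11811056310428251732669910094690917832478506769950723840056431648 121259393890130 = true := by decide +kernel

/-- **M_4500(F_{c,T}) > 8** for Polymath's product test function with `c = 243/2000`, `T = 13/20`
(hence `M_4500 > 8`; with an admissible 4500-tuple of diameter 41664 this is the `m = 3` bounded-gaps input).
[cite: Polymath8b2014, Theorem 6.7 (product test function), numerical instance k = 4500] -/
theorem eight_lt_maynardFunctional_4500 :
    (8 : ℝ) < Literature.NumberTheory.Sieve.maynardFunctional 4500
      (Literature.NumberTheory.Sieve.MaynardTao.productTestFn 4500
        (Literature.NumberTheory.Sieve.MaynardTao.polymathProfile 4500 ((243 : ℝ) / 2000) ((13 : ℝ) / 20))) := by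
  have h : ((801 : ℕ) : ℝ) / ((100 : ℕ) : ℝ) ≤ maynardFunctional (4498 + 2) (productTestFn (4498 + 2)
      (polymathProfile (4498 + 2) (((243 : ℕ) : ℝ) / ((2000 : ℕ) : ℝ)) (((13 : ℕ) : ℝ) / ((20 : ℕ) : ℝ)))) :=
    theta_le_of_factsH _ _ okF okC okS okI
  have h8 : (8 : ℝ) < ((801 : ℕ) : ℝ) / ((100 : ℕ) : ℝ) := by norm_num
  have e2 : ((243 : ℕ) : ℝ) / ((2000 : ℕ) : ℝ) = (243 : ℝ) / 2000 := by norm_num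
  have e3 : ((13 : ℕ) : ℝ) / ((20 : ℕ) : ℝ) = (13 : ℝ) / 20 := by norm_num
  rw [show (4498 + 2 : ℕ) = 4500 from rfl, e2, e3] at h
  exact lt_of_lt_of_le h8 h

end Literature.NumberTheory.Sieve.MaynardTao.ProductKernelCert

/-- `8 < M_4500(F_{243/2000, 13/20})` — alias at the `MaynardTao` level.
[cite: Polymath8b2014, Theorem 6.7 (product test function), numerical instance k = 4500] -/
theorem Literature.NumberTheory.Sieve.MaynardTao.eight_lt_maynardFunctional_4500 :
    (8 : ℝ) < Literature.NumberTheory.Sieve.maynardFunctional 4500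
      (Literature.NumberTheory.Sieve.MaynardTao.productTestFn 4500
        (Literature.NumberTheory.Sieve.MaynardTao.polymathProfile 4500 ((243 : ℝ) / 2000) ((13 : ℝ) / 20))) :=
  Literature.NumberTheory.Sieve.MaynardTao.ProductKernelCert.eight_lt_maynardFunctional_4500
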